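import Literature.MathematicalPhysics.QuantumFieldTheory.Balaban1983to89.B9RWSums344InputPair
import Literature.MathematicalPhysics.QuantumFieldTheory.Balaban1983to89.B9CoRealizesRel

/-!
# `Balaban1983to89.B9RWSumsAllBlocksPairM` — Theorems 3.7 and 3.10 of [B9] at the ALL-BLOCKS pins with NO displayed residual (v4): EVERY
# two-direction member — the three second-order L² members of (3.46) AND the (3.44)∕(3.45) members — read on DIRECTION-PAIR FAMILIES

T. Bałaban, *Propagators for lattice gauge theories in a background field*, Commun. Math. Phys. **99** (1985) 389–434
[`Balaban1985BackgroundPropagators`, "B9"], Thm 3.7 (3.88)–(3.90) p. 409, Thm 3.10 (3.105)–(3.108) pp. 414–416, Thm 3.1 ∕ 3.3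
(3.42)–(3.47) pp. 397–399; p. 410: *"Theorem 3.7 implies that all the inequalities (3.42)–(3.47) hold for G′"*; p. 416: *"From (3.108)
it follows that the expansion (3.107) is convergent in all norms in the inequalities (3.42)–(3.47). This implies Theorem 3.3."*;
[4] = T. Bałaban, *Propagators and renormalization transformations for lattice gauge theories. II*, Commun. Math. Phys. **96** (1984)
223–250 [`Balaban1984PropagatorsII`], (2.51)–(2.52) p. 232, Lemma 2.1 p. 234.

statement-level skeleton of published theorems with citation tags; proofs where landed; nothing here is a claim about the
Yang–Mills mass gap

WHY THIS FILE (v4 of the all-blocks leaves = `B9RWSumsAllBlocksPair` v3.1 with the MIXED members re-modelled; this seat's located point (O4′):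
at the record's coordinate pins the one-slot letters compose slice-wise, `B9CoReadingCoords.coordOpK_comp`, so the one-slot model
`D ∘ₗ (G ∘ₗ Dstar)` of v3.1's `hl3` and `hIR` carries only the diagonal direction pairs while def-Y's `kernelFamilyB.l2 3`, `.e4`, `.h2` take
`⨆ ν, ⨆ μ` — here `hl3` reads the family `familyOp fun p => Dd p.1 ∘ₗ (G ∘ₗ Dsd p.2)` (`B9RWSums346MixedPair`) and `hIR` is the family schema
`B9RWSums344InputFam.InputReadsFam` on the same model with SLICED X-probes (`B9RWSums344InputPair`); the Y-lattice input letter `bH` and the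
one-slot schemas `L2TwoLegs…`, `FactorsL2_…`, `InputLegs…`, `FactorsInput…` are replaced by their per-pair forms `L2MixedLegs…`,
`FactorsL2Mixed…`, `InputLegsPair…`, `FactorsInputPair…` with the X-lattice input letter `bHX`, plus the component laws `DirSup…`,
`DirSupHolder…` of the direction letters).  History of the lineage: the `Rel` leaves of this lineage (`B9RWSumsAllBlocksRel.thm310Printed_allPin_completeRel`,
`thm37Printed_allPin_completeRel`, p495821) read the (3.43)–(3.46) members through the schemas `L2ReadsRel` ∕ `H1ReadsRel` ∕ `InputReadsRel`,
whose observation is sited on the CLASS of y; at the record geometry (`geo9Y x = geo9K x.toKIdx`) the cut-off predicates `cutIn = cutInT`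
are the Δ̃-reading and n06-d's coordinate evaluation `evBK` over-counts the fibre-L² size, so those schemas are not dischargeable there
(`B9RWSumsReadsRelNegative.not_l2ReadsRel_evBK`; the located obstructions (O1)∕(O2) of this seat's reading layer).  This file re-derives
BOTH leaves with the (3.43)–(3.46) co-readings in the NEIGHBOURHOOD-SITED species `B9RWSumsReadsNbr.L2ReadsNbr` ∕ `H1ReadsNbr` ∕
`InputReadsNbr` (support side still relative to `Rel`; observation radius `r`; evaluation constant `Cev`), keeping the (3.42) co-readings
`CoRealizesRel` (n06-l) and the (3.47) readings `GlobReads` unchanged.  The new geometric binders are the neighbourhood count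
`(nbr g r y).card ≤ mN`, the level comparability `d(a,a′) ≤ r ⇒ Lʲ⁽ᵃ⁾η ≤ CL·Lʲ⁽ᵃ′⁾η` (1 ≦ CL), the triangle inequality of d and 0 ≦ δ₀;
the multiplicities are folded into the constants' relations (mN·m·Cev·CL²·e^{rδ₀}·C·L₀ ≦ B₀ etc.).  The member lines are proved through the
siblings' READING-FREE operator lemmas (`blockBd_entry0∕1∕2`, `blockBd_pair_of_transpose`, `holder343_of_local310∕37`, `lap_of_local310∕37`,
`inputPair3445_family(_37)`, `blockBd_mixed_family(_37)`, `blockBd_second_family3∕5(_37)`) and the neighbourhood ∕ family reading engines of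
`B9RWSumsReadsNbr` ∕ `B9RWSums344InputFam` — no chain of intermediate leaves.
THE SECOND-ORDER L² MEMBERS (what is new versus `B9RWSumsAllBlocksNbr`, p504435).  Per the lit-balaban desk answer of record (2026-08-27)
print's three second-order members of (3.46) are ‖h∇_U∇_UGλ‖, ‖h∇_UG∇\*_Uλ‖, ‖hG∇\*_U∇\*_Uλ‖ (all with the prefactor 1 of `B9.pref6`), NOT
the Laplacian traces `Lap ∘ₗ G`, `G ∘ₗ Lap` of the `Nbr` leaves.  Here the two-direction members are modelled by the DIRECTION-PAIR FAMILIES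
of `B9RWSums346SecondDiff(Gp)` packaged into one map `X → X × (Q × Q)` (`familyOp`): `familyOp fun p => (Dd p.1 ∘ₗ Dd p.2) ∘ₗ G` (∇∇G) and
`familyOp fun p => G ∘ₗ (Dsd p.1 ∘ₗ Dsd p.2)` (G∇*∇*), with block maps `blk ∘ Prod.fst` and the operator-level block bounds
`blockBd_second_family3∕5(_37)` (constant `|Q×Q|·secondConst`, folded as `NQ·secondConst` into `mN·m·Cev·CL²·e^{rδ₀}·(NQ·secondConst) ≦ B₀`);
the mixed member ∇G∇\* is the pair family `familyOp fun p => Dd p.1 ∘ₗ (G ∘ₗ Dsd p.2)` of `B9RWSums346MixedPair` (constant `NQ·mixedConst`),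
and the (3.44)∕(3.45) members read the SAME family through `InputReadsFam` with the sliced X-probes.  K-INDEX CONVENTION (as v3.1): the index
`n : Fin 6` of `K.l2 n` follows def-Y's instance `Node00.OpsYOfLetters.kernelFamilyB.l2` — n = 3 ↦ ‖h∇G∇\*λ‖ (mixed pair family
`Dd ∘ G ∘ Dsd`, blocks `blk ∘ Prod.fst`), n = 4 ↦ ‖h∇∇Gλ‖ (pair family `DdDd ∘ G`), n = 5 ↦ ‖hG∇\*∇\*λ‖ (pair family `G ∘ DsdDsd`); the printed right-hand side is the
same for the three (`pref6 _ 3 = pref6 _ 4 = pref6 _ 5 = 1`), so the convention only decides WHICH model reads WHICH member of the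
instance.

* §0 private bookkeeping (weakening a line's constant; a probe majorant's constant ∕ rate; the six L² lines; «M sufficiently large»).
* §1 ★ `allIneqs_of_majorants_pairM` — Theorem 3.1 ∕ 3.3's whole typed block `Ineq342_346_347 K B₀ δ₀ U ∧ Ineq343_345 K Bβ Bε Bεβ δ₀ U`
  at one member and one U from the four sup majorants, the operator-level majorants of the other members, the relative (3.42)
  co-readings and the neighbourhood-sited (3.43)–(3.46) co-readings (constants: m·C ≦ B₀, mN·m·Cev·CL²·e^{rδ₀}·C·L₀ ≦ B₀,
  mN·m·Cev·CL²·e^{rδ₀}·K₃ ≦ B₀ (pair families ∇∇G, G∇\*∇\*), mN·m·Cev·CL²·e^{rδ₀}·K_M ≦ B₀ (mixed family), m·CL·e^{rδ₀}·B_h(β) ≦ B(β),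
  e^{rδ₀}·K₄₄(ε) ≦ B′(ε), CL·e^{rδ₀}·K₄₅(ε,β) ≦ B′(ε,β)).
* §2 ★★ `thm310Printed_allPin_completePairM` — Theorem 3.10 at `W310OfOps … (ConvAll3107 … K B₀ δ₀ Bβ Bε Bεβ)`, G side.
* §3 ★★ `thm37Printed_allPin_completePairM` — Theorem 3.7 at `E37AllOfOps …`, G′ side.

HONEST SCOPE.  Kernel bookkeeping over landed modules; every operator-level input (Cor. 3.6's blocks and legs, (3.89), the structure
(3.88) ∕ (3.105), the static sizes), every co-reading schema, every letter and the member facts of [4] Lemma 2.1 remain HYPOTHESES of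
printed shape; the record-level instance of `Rel` (same carrier block), m, mN, Cev, CL and the saturation facts are the instance seat's
(at `geo9Y`: `CL := ℓ+1` from the level gap, the triangle inequality and symmetry by name).  NOT a node discharge; count-neutral; one finite
𝕋^{d+1} programme at fixed ε — nothing continuum, nothing about the mass gap.  Cell `pub-ymgap` (HUMAN RULING D-0062), Track A node N06
[B9], N06-ASSIGNMENT v1 bundle F6 (rows 18–19), seat `pub-ymgap-dag-n06-k` (gen 8), 2026-08-27.
-/

namespace Literature.MathematicalPhysics.QuantumFieldTheory.Balaban1983to89.B9RWSumsAllBlocksPairM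

open Literature.MathematicalPhysics.QuantumFieldTheory.Balaban1983to89
open Finset B6RandomWalk B6RandomWalkHom B9Thm34Ext B9Thm37Whole B9Cor38Whole B9Thm310Whole B9RWSums343to347Whole
open B9RWSums346Schur B9RWSums343Holder B9RWSums346Lap B9RWSums344Input B9RWSums346Two B9Thm37GlueCor36
open B9SectCDiffDict B9SectDL2Decay B11SectG B9Thm37AllNorms B9Thm37AllNormsInstances B9Ineq347 B9Ineq347AllEntries
open B9CoRealizesRel B9RWSumsReadsRel B9RWSumsReadsNbr B9RWSums346SecondDiff B9RWSums346SecondDiffGp B9Thm37Sum B9Thm37Glue B9RWSums343HolderGp B9RWSums344InputGp B9RWSums346TwoGp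
open B9RWSums346MixedPair B9RWSums344InputFam B9RWSums344InputPair

noncomputable section

/-! ## §0 Bookkeeping helpers (weakening a member line's constant; a probe majorant's constant ∕ rate) -/

section Helpers

variable {g : B9.Geometry} [Fintype g.Site] {R : ℝ} {H : Prop} {B : B9.Backgrounds}

omit [Fintype g.Site] in
/-- weakening the constant of an L² line of (3.46). [folklore] -/
private theorem l2line_weaken' {K : B9.KernelFamily g B} {U : B.Cfg} {n : Fin 6} {b b' δ₀ : ℝ} (hbb : b ≤ b')
    (hlen : ∀ y : g.Site, 0 ≤ g.len y) (hcut : ∀ h : g.Cut, 0 ≤ g.cutSup h) (hl2 : ∀ lam : g.Loc, 0 ≤ g.l2Norm lam)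
    (h : ∀ (lam : g.Loc) (h : g.Cut) (y y' : g.Site), g.cutIn h y → g.suppIn lam y' →
      K.l2 n U lam h ≤ b * B9.pref6 (g.len y) n * g.cutSup h * Real.exp (-(δ₀ * g.dist y y')) * g.l2Norm lam) :
    ∀ (lam : g.Loc) (h : g.Cut) (y y' : g.Site), g.cutIn h y → g.suppIn lam y' →
      K.l2 n U lam h ≤ b' * B9.pref6 (g.len y) n * g.cutSup h * Real.exp (-(δ₀ * g.dist y y')) * g.l2Norm lam :=
  fun lam hh y y' hc hs => (h lam hh y y' hc hs).trans
    (mul_le_mul_of_nonneg_right (mul_le_mul_of_nonneg_right (mul_le_mul_of_nonneg_right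
      (mul_le_mul_of_nonneg_right hbb (B9FromB6.pref6_nonneg (hlen y) n)) (hcut hh)) (Real.exp_nonneg _)) (hl2 lam))

omit [Fintype g.Site] in
/-- weakening the constant of the (3.43) line. [folklore] -/
private theorem line343_weaken' {K : B9.KernelFamily g B} {U : B.Cfg} {b b' : ℝ → ℝ} {δ₀ : ℝ}
    (hbb : ∀ β, 0 ≤ β → β < 1 → b β ≤ b' β) (hlen : ∀ y : g.Site, 0 ≤ g.len y)
    (hcutH : ∀ (β : ℝ) (ζ : g.Cut), 0 ≤ g.cutH β ζ) (hN : ∀ lam : g.Loc, 0 ≤ g.supNorm lam)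
    (h : ∀ (β : ℝ) (lam : g.Loc) (ζ : g.Cut) (y y' : g.Site), 0 ≤ β → β < 1 → g.cutInT ζ y → g.suppIn lam y' →
      K.h1 U lam β ζ ≤ b β * (g.len y) ^ (1 - β) * g.cutH β ζ * Real.exp (-(δ₀ * g.dist y y')) * g.supNorm lam) :
    ∀ (β : ℝ) (lam : g.Loc) (ζ : g.Cut) (y y' : g.Site), 0 ≤ β → β < 1 → g.cutInT ζ y → g.suppIn lam y' →
      K.h1 U lam β ζ ≤ b' β * (g.len y) ^ (1 - β) * g.cutH β ζ * Real.exp (-(δ₀ * g.dist y y')) * g.supNorm lam :=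
  fun β lam ζ y y' hβ0 hβ1 hζ hs => (h β lam ζ y y' hβ0 hβ1 hζ hs).trans
    (mul_le_mul_of_nonneg_right (mul_le_mul_of_nonneg_right (mul_le_mul_of_nonneg_right
      (mul_le_mul_of_nonneg_right (hbb β hβ0 hβ1) (Real.rpow_nonneg (hlen y) _)) (hcutH β ζ)) (Real.exp_nonneg _)) (hN lam))

omit [Fintype g.Site] in
/-- weakening the constant of the (3.44) line. [folklore] -/
private theorem line344_weaken' {K : B9.KernelFamily g B} {U : B.Cfg} {b b' : ℝ → ℝ} {δ₀ : ℝ}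
    (hbb : ∀ ε, 0 < ε → ε ≤ 1 → b ε ≤ b' ε) (hhs : ∀ (ε : ℝ) (lam : g.Loc), 0 ≤ g.holder ε lam + g.supNorm lam)
    (h : ∀ (ε : ℝ) (lam : g.Loc) (y y' : g.Site), 0 < ε → ε ≤ 1 → g.suppInT lam y' →
      K.e4 U lam y ≤ b ε * Real.exp (-(δ₀ * g.dist y y')) * (g.holder ε lam + g.supNorm lam)) :
    ∀ (ε : ℝ) (lam : g.Loc) (y y' : g.Site), 0 < ε → ε ≤ 1 → g.suppInT lam y' →
      K.e4 U lam y ≤ b' ε * Real.exp (-(δ₀ * g.dist y y')) * (g.holder ε lam + g.supNorm lam) :=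
  fun ε lam y y' hε0 hε1 hs => (h ε lam y y' hε0 hε1 hs).trans
    (mul_le_mul_of_nonneg_right (mul_le_mul_of_nonneg_right (hbb ε hε0 hε1) (Real.exp_nonneg _)) (hhs ε lam))

omit [Fintype g.Site] in
/-- weakening the constant of the (3.45) line. [folklore] -/
private theorem line345_weaken' {K : B9.KernelFamily g B} {U : B.Cfg} {b b' : ℝ → ℝ → ℝ} {δ₀ : ℝ}
    (hbb : ∀ ε β, 0 < ε → ε ≤ 1 → 0 ≤ β → β < 1 → b ε β ≤ b' ε β) (hlen : ∀ y : g.Site, 0 ≤ g.len y)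
    (hcutH : ∀ (β : ℝ) (ζ : g.Cut), 0 ≤ g.cutH β ζ) (hhs : ∀ (ε : ℝ) (lam : g.Loc), 0 ≤ g.holder ε lam + g.supNorm lam)
    (h : ∀ (ε β : ℝ) (lam : g.Loc) (ζ : g.Cut) (y y' : g.Site), 0 < ε → ε ≤ 1 → 0 ≤ β → β < 1 →
      g.cutInT ζ y → g.suppInT lam y' →
      K.h2 U lam β ζ ≤ b ε β * (g.len y) ^ (-β) * g.cutH β ζ * Real.exp (-(δ₀ * g.dist y y')) *
        (g.holder (β + ε) lam + g.supNorm lam)) :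
    ∀ (ε β : ℝ) (lam : g.Loc) (ζ : g.Cut) (y y' : g.Site), 0 < ε → ε ≤ 1 → 0 ≤ β → β < 1 →
      g.cutInT ζ y → g.suppInT lam y' →
      K.h2 U lam β ζ ≤ b' ε β * (g.len y) ^ (-β) * g.cutH β ζ * Real.exp (-(δ₀ * g.dist y y')) *
        (g.holder (β + ε) lam + g.supNorm lam) :=
  fun ε β lam ζ y y' hε0 hε1 hβ0 hβ1 hζ hs => (h ε β lam ζ y y' hε0 hε1 hβ0 hβ1 hζ hs).trans
    (mul_le_mul_of_nonneg_right (mul_le_mul_of_nonneg_right (mul_le_mul_of_nonneg_right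
      (mul_le_mul_of_nonneg_right (hbb ε β hε0 hε1 hβ0 hβ1) (Real.rpow_nonneg (hlen y) _)) (hcutH β ζ)) (Real.exp_nonneg _))
      (hhs (β + ε) lam))

/-- a probe majorant of the printed shape with a larger constant and a slower rate (twin of the sibling's private `probeMaj_mono`).
[folklore] -/
private theorem probeMaj_mono'' {W Z : Type} (blkW : W → g.Site) (blkZ : Z → g.Site) {T : (W → ℝ) →ₗ[ℝ] (Z → ℝ)}
    {c c' δ δ' β : ℝ} (h : HasMajorantHom (g := toB6 g R H) blkW blkZ T
      (fun (a b : g.Site) => c * g.len a ^ (1 - β) * Real.exp (-(δ * g.dist a b))))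
    (hcc' : c ≤ c') (hδ : δ' ≤ δ) (hdnn : ∀ a b : g.Site, 0 ≤ g.dist a b)
    (hlen : ∀ y : g.Site, 0 ≤ g.len y) (hc : 0 ≤ c) :
    HasMajorantHom (g := toB6 g R H) blkW blkZ T
      (fun (a b : g.Site) => c' * g.len a ^ (1 - β) * Real.exp (-(δ' * g.dist a b))) := by
  refine hasMajorantHom_mono (g := toB6 g R H) blkW blkZ h fun a b => ?_
  have hW : 0 ≤ g.len a ^ (1 - β) := Real.rpow_nonneg (hlen a) _
  have hexp : Real.exp (-(δ * g.dist a b)) ≤ Real.exp (-(δ' * g.dist a b)) :=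
    Real.exp_le_exp.mpr (neg_le_neg (mul_le_mul_of_nonneg_right hδ (hdnn a b)))
  exact mul_le_mul (mul_le_mul_of_nonneg_right hcc' hW) hexp (Real.exp_nonneg _)
    (mul_nonneg (hc.trans hcc') hW)

omit [Fintype g.Site] in
/-- the six L² lines from the lines 0, 1, 2, 3, 4, 5. [folklore] -/
private theorem l2lines_of_six' {K : B9.KernelFamily g B} {U : B.Cfg} {B₀ δ₀ : ℝ}
    (h0 : ∀ (lam : g.Loc) (h : g.Cut) (y y' : g.Site), g.cutIn h y → g.suppIn lam y' →
        K.l2 0 U lam h ≤ B₀ * B9.pref6 (g.len y) 0 * g.cutSup h * Real.exp (-(δ₀ * g.dist y y')) * g.l2Norm lam)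
    (h1 : ∀ (lam : g.Loc) (h : g.Cut) (y y' : g.Site), g.cutIn h y → g.suppIn lam y' →
        K.l2 1 U lam h ≤ B₀ * B9.pref6 (g.len y) 1 * g.cutSup h * Real.exp (-(δ₀ * g.dist y y')) * g.l2Norm lam)
    (h2 : ∀ (lam : g.Loc) (h : g.Cut) (y y' : g.Site), g.cutIn h y → g.suppIn lam y' →
        K.l2 2 U lam h ≤ B₀ * B9.pref6 (g.len y) 2 * g.cutSup h * Real.exp (-(δ₀ * g.dist y y')) * g.l2Norm lam)
    (h3 : ∀ (lam : g.Loc) (h : g.Cut) (y y' : g.Site), g.cutIn h y → g.suppIn lam y' →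
        K.l2 3 U lam h ≤ B₀ * B9.pref6 (g.len y) 3 * g.cutSup h * Real.exp (-(δ₀ * g.dist y y')) * g.l2Norm lam)
    (h4 : ∀ (lam : g.Loc) (h : g.Cut) (y y' : g.Site), g.cutIn h y → g.suppIn lam y' →
        K.l2 4 U lam h ≤ B₀ * B9.pref6 (g.len y) 4 * g.cutSup h * Real.exp (-(δ₀ * g.dist y y')) * g.l2Norm lam)
    (h5 : ∀ (lam : g.Loc) (h : g.Cut) (y y' : g.Site), g.cutIn h y → g.suppIn lam y' →
        K.l2 5 U lam h ≤ B₀ * B9.pref6 (g.len y) 5 * g.cutSup h * Real.exp (-(δ₀ * g.dist y y')) * g.l2Norm lam) :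
    ∀ (n : Fin 6) (lam : g.Loc) (h : g.Cut) (y y' : g.Site), g.cutIn h y → g.suppIn lam y' →
      K.l2 n U lam h ≤ B₀ * B9.pref6 (g.len y) n * g.cutSup h * Real.exp (-(δ₀ * g.dist y y')) * g.l2Norm lam := by
  intro n
  fin_cases n
  · exact h0
  · exact h1
  · exact h2
  · exact h3
  · exact h4
  · exact h5

end Helpers

/-! ## §1 ★ All blocks of Theorems 3.1 ∕ 3.3 for a kernel family, (3.43)–(3.46) read ON THE NEIGHBOURHOOD, at one member and one U -/

section OneMember

variable {g : B9.Geometry} [Fintype g.Site] [DecidableEq g.Site] {R : ℝ} {H : Prop} {B : B9.Backgrounds}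
variable {X Y PX PY Q : Type} [Fintype X] [Fintype Y] [Fintype PX] [Fintype Q]

/-- ★ **THE TYPED CONCLUSION OF THEOREM 3.1 ∕ 3.3 FOR A KERNEL FAMILY `K` AT `U`, EVERY MEMBER PROVED, FROM THE OPERATOR-LEVEL
MAJORANTS, THE RELATIVE (3.42) CO-READINGS AND THE NEIGHBOURHOOD-SITED (3.43)–(3.46) CO-READINGS** (the `Nbr` form of
`B9RWSumsAllBlocksRel.allIneqs_of_majorants_rel`; p. 410 ∕ p. 416: *"all the inequalities (3.42)–(3.47) hold"*).  Inputs at one member and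
one U: the four sup majorants (C, δ) of A₀ = G, A₁ = ∇_UG, A₂ = G∇\*_U, A₃ = Δ_UG; the operator-level majorants of the remaining members — the
probe majorants of Φ^Y_β∘A₁ and Φ^X_β∘A₂ (B_h(β), δ), the scale-weighted majorant of A₅ = GΔ_U (K₅, δ₅), the input block-norm majorants of
A₄ = ∇_UG∇\*_U (K₄₄(ε), K₄₅(ε, β), (1 − α)δ) and its L² block bound (K₄, (1 − 2α)δ); the transpose letters; the co-readings `CoRealizesRel`
(n06-l), `GlobReads`, `L2ReadsNbr`, `H1ReadsNbr`, `InputReadsNbr` (class multiplicity ≦ m, Lʲη and d saturated on classes; observation radius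
r with neighbourhood count ≦ mN, level comparability CL, evaluation constant Cev); the member facts; the signs; and the constants' relations:
m·C ≦ B₀, C·c₁(1 − α)·L₀⁴ ≦ B₀, mN·m·Cev·CL²·e^{rδ₀}·C·L₀ ≦ B₀, mN·m·Cev·CL²·e^{rδ₀}·√(CK₅)·L₀ ≦ B₀, mN·m·Cev·CL²·e^{rδ₀}·K₄ ≦ B₀,
m·CL·e^{rδ₀}·B_h(β) ≦ B(β), e^{rδ₀}·K₄₄(ε) ≦ B′(ε), CL·e^{rδ₀}·K₄₅(ε, β) ≦ B′(ε, β); rates 0 ≦ δ₀ ≦ (1 − 2α)δ ≦ (1 − α)δ ≦ δ ≦ δ₅.  Output: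
`B9.Ineq342_346_347 K B₀ δ₀ U ∧ B9.Ineq343_345 K Bβ Bε Bεβ δ₀ U`. [cite: Balaban1985BackgroundPropagators, Thm 3.1 ∕ 3.3 (3.42)–(3.47) pp.397–399 + Thm 3.7 ⇒ Thm 3.1 p.410 + Thm 3.10 ⇒ Thm 3.3 p.416; Balaban1984PropagatorsII, (2.51)–(2.52) p.232 + Lemma 2.1 p.234] -/
theorem allIneqs_of_majorants_pairM {K : B9.KernelFamily g B} {U : B.Cfg} (𝔭 : HolderProbes g B X Y PX PY)
    (bHX : ℝ → BlockNorm (toB6 g R H) (X → ℝ)) (blk : X → g.Site) (blkY : Y → g.Site)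
    (ev : g.Loc → X → ℝ) (evY : g.Loc → Y → ℝ)
    {A0 A3 : Module.End ℝ (X → ℝ)} {A1 : (X → ℝ) →ₗ[ℝ] (Y → ℝ)} {A2 : (Y → ℝ) →ₗ[ℝ] (X → ℝ)}
    {A3f A4f A5f : (X → ℝ) →ₗ[ℝ] (X × Q → ℝ)}
    (Rel : g.Site → g.Site → Prop) [DecidableRel Rel] (m : ℕ) (r Cev CL : ℝ) (mN : ℕ)
    (hRlen : ∀ a a', Rel a a' → g.len a = g.len a') (hRd₁ : ∀ a a' b, Rel a a' → g.dist a b = g.dist a' b)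
    (hRd₂ : ∀ a b b', Rel b b' → g.dist a b = g.dist a b')
    (hmult : ∀ y' : g.Site, (Finset.univ.filter (fun y'' => Rel y'' y')).card ≤ m)
    (hnbr : ∀ y : g.Site, (nbr g r y).card ≤ mN) (hCL1 : 1 ≤ CL)
    (hCLcmp : ∀ a a' : g.Site, g.dist a a' ≤ r → g.len a ≤ CL * g.len a')
    (htri : ∀ a b c : g.Site, g.dist a c ≤ g.dist a b + g.dist b c) (hCev : 0 ≤ Cev)
    {d : ℕ} {C δ α L₀ B₀ δ₀ KM K₃ : ℝ} {Bh Bβ Bε K44 : ℝ → ℝ} {Bεβ K45 : ℝ → ℝ → ℝ}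
    (h0 : HasMajorant (g := toB6 g R H) blk A0 (fun (a b : g.Site) => C * g.len a ^ 2 * Real.exp (-(δ * g.dist a b))))
    (h1 : HasMajorantHom (g := toB6 g R H) blk blkY A1 (fun (a b : g.Site) => C * g.len a * Real.exp (-(δ * g.dist a b))))
    (h2 : HasMajorantHom (g := toB6 g R H) blkY blk A2 (fun (a b : g.Site) => C * g.len a * Real.exp (-(δ * g.dist a b))))
    (h3 : HasMajorantHom (g := toB6 g R H) blk blk A3 (fun (a b : g.Site) => C * Real.exp (-(δ * g.dist a b))))
    (hH : ∀ β : ℝ, 0 ≤ β → β < 1 →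
      HasMajorantHom (g := toB6 g R H) blk 𝔭.blkPY (𝔭.ΦY U β ∘ₗ A1)
          (fun (a b : g.Site) => Bh β * g.len a ^ (1 - β) * Real.exp (-(δ * g.dist a b))) ∧
        HasMajorantHom (g := toB6 g R H) blkY 𝔭.blkPX (𝔭.ΦX U β ∘ₗ A2)
          (fun (a b : g.Site) => Bh β * g.len a ^ (1 - β) * Real.exp (-(δ * g.dist a b))))
    (hb3f : BlockBd (g := toB6 g R H) blk (blk ∘ Prod.fst) A3f (fun (a b : g.Site) => KM * Real.exp (-((1 - 2 * α) * δ * g.dist a b))))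
    (hb4f : BlockBd (g := toB6 g R H) blk (blk ∘ Prod.fst) A4f (fun (a b : g.Site) => K₃ * Real.exp (-((1 - 2 * α) * δ * g.dist a b))))
    (hb5 : BlockBd (g := toB6 g R H) blk (blk ∘ Prod.fst) A5f (fun (a b : g.Site) => K₃ * Real.exp (-((1 - 2 * α) * δ * g.dist a b))))
    (h44 : ∀ ε : ℝ, 0 < ε → ε ≤ 1 → HasMaj (bHX ε) (BlockNorm.ofBlocks (toB6 g R H) (blk ∘ Prod.fst)) A3f
      (fun (a b : g.Site) => K44 ε * Real.exp (-((1 - α) * δ * g.dist a b))))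
    (h45 : ∀ ε β : ℝ, 0 < ε → ε ≤ 1 → 0 ≤ β → β < 1 →
      HasMaj (bHX (β + ε)) (BlockNorm.ofBlocks (toB6 g R H) (𝔭.blkPX ∘ Prod.fst)) (sliceProbe (𝔭.ΦX U β) ∘ₗ A3f)
        (fun (a b : g.Site) => K45 ε β * g.len a ^ (-β) * Real.exp (-((1 - α) * δ * g.dist a b))))
    (hsym : IsTransposePair A0 A0) (htr : IsTransposePair A1 A2)
    (hco0 : CoRealizesRel K 0 U Rel blk blk ev A0) (hco1 : CoRealizesRel K 1 U Rel blkY blk ev A1)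
    (hco2 : CoRealizesRel K 2 U Rel blk blkY evY A2) (hco3 : CoRealizesRel K 3 U Rel blk blk ev A3)
    (hgl0 : GlobReads K 0 U blk blk ev A0) (hgl1 : GlobReads K 1 U blkY blk ev A1)
    (hgl2 : GlobReads K 2 U blk blkY evY A2) (hgl3 : GlobReads K 3 U blk blk ev A3)
    (hl0 : L2ReadsNbr (R := R) (H := H) K 0 U Rel r Cev blk blk ev A0)
    (hl1 : L2ReadsNbr (R := R) (H := H) K 1 U Rel r Cev blkY blk ev A1)
    (hl2 : L2ReadsNbr (R := R) (H := H) K 2 U Rel r Cev blk blkY evY A2)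
    (hl3 : L2ReadsNbr (R := R) (H := H) K 3 U Rel r Cev (blk ∘ Prod.fst) blk ev A3f)
    (hl4 : L2ReadsNbr (R := R) (H := H) K 4 U Rel r Cev (blk ∘ Prod.fst) blk ev A4f)
    (hl5 : L2ReadsNbr (R := R) (H := H) K 5 U Rel r Cev (blk ∘ Prod.fst) blk ev A5f)
    (hH1 : H1ReadsNbr K U 𝔭 Rel r blk blkY ev evY A1 A2)
    (hIR : InputReadsFam K U bHX r (blk ∘ Prod.fst) (𝔭.blkPX ∘ Prod.fst) (fun β => sliceProbe (𝔭.ΦX U β)) ev A3f)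
    (hF : Facts347 g R H d δ α L₀) (hsymm : ∀ y y' : g.Site, g.dist y y' = g.dist y' y)
    (hdnn : ∀ a b : g.Site, 0 ≤ g.dist a b) (hlen : ∀ y : g.Site, 0 < g.len y)
    (hC : 0 ≤ C) (hK₃ : 0 ≤ K₃) (hKM : 0 ≤ KM) (hBh : ∀ β, 0 ≤ β → β < 1 → 0 ≤ Bh β)
    (hK44 : ∀ ε, 0 < ε → ε ≤ 1 → 0 ≤ K44 ε) (hK45 : ∀ ε β, 0 < ε → ε ≤ 1 → 0 ≤ β → β < 1 → 0 ≤ K45 ε β)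
    (hα : 0 ≤ α * δ) (hδ₀nn : 0 ≤ δ₀) (hδ₀ : δ₀ ≤ (1 - α) * δ) (hδ₀2 : δ₀ ≤ (1 - 2 * α) * δ)
    (hCB : (m : ℝ) * C ≤ B₀) (hCg : C * B6.c1 d δ (1 - α) * L₀ ^ (4 : ℝ) ≤ B₀)
    (hCL : (mN : ℝ) * m * Cev * CL ^ 2 * Real.exp (r * δ₀) * (C * L₀) ≤ B₀)
    (hB3 : (mN : ℝ) * m * Cev * CL ^ 2 * Real.exp (r * δ₀) * K₃ ≤ B₀)
    (hBM : (mN : ℝ) * m * Cev * CL ^ 2 * Real.exp (r * δ₀) * KM ≤ B₀)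
    (hBβ : ∀ β, 0 ≤ β → β < 1 → (m : ℝ) * CL * Real.exp (r * δ₀) * Bh β ≤ Bβ β)
    (hBε : ∀ ε, 0 < ε → ε ≤ 1 → Real.exp (r * δ₀) * K44 ε ≤ Bε ε)
    (hBεβ : ∀ ε β, 0 < ε → ε ≤ 1 → 0 ≤ β → β < 1 → CL * Real.exp (r * δ₀) * K45 ε β ≤ Bεβ ε β) :
    B9.Ineq342_346_347 K B₀ δ₀ U ∧ B9.Ineq343_345 K Bβ Bε Bεβ δ₀ U := by
  have hlen0 : ∀ y : g.Site, 0 ≤ g.len y := fun y => (hlen y).le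
  have hm : (0 : ℝ) ≤ m := Nat.cast_nonneg m
  have hmC : 0 ≤ (m : ℝ) * C := mul_nonneg hm hC
  have hB₀ : 0 ≤ B₀ := hmC.trans hCB
  have hδ₀' : δ₀ ≤ δ := hδ₀.trans (by nlinarith [hα])
  have hN : ∀ lam : g.Loc, 0 ≤ g.supNorm lam := hco0.norm_nonneg
  have hL₀ : 0 ≤ L₀ := le_trans (le_trans zero_le_one hF.one_le_L) hF.L_le
  have hexp : ∀ a b : g.Site, Real.exp (-((1 - α) * δ * g.dist a b)) ≤ Real.exp (-(δ₀ * g.dist a b)) := fun a b =>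
    Real.exp_le_exp.mpr (neg_le_neg (mul_le_mul_of_nonneg_right hδ₀ (hdnn a b)))
  have hexp2 : ∀ a b : g.Site, Real.exp (-((1 - 2 * α) * δ * g.dist a b)) ≤ Real.exp (-(δ₀ * g.dist a b)) := fun a b =>
    Real.exp_le_exp.mpr (neg_le_neg (mul_le_mul_of_nonneg_right hδ₀2 (hdnn a b)))
  -- saturation of the printed (3.42) majorants on the classes
  have hsat₁ : ∀ (n : Fin 4) (a a' b : g.Site), Rel a a' → maj342 g n C δ a b = maj342 g n C δ a' b :=
    fun n a a' b hr => by simp only [maj342]; rw [hRlen a a' hr, hRd₁ a a' b hr]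
  have hsat₂ : ∀ (n : Fin 4) (a b b' : g.Site), Rel b b' → maj342 g n C δ a b = maj342 g n C δ a b' :=
    fun n a b b' hr => by simp only [maj342]; rw [hRd₂ a b b' hr]
  have hm0 : HasMajorantHom (g := toB6 g R H) blk blk A0 (maj342 g 0 C δ) := by
    rw [maj342_zero]; exact (hasMajorantHom_iff (g := toB6 g R H) blk A0 _).mpr h0
  have hm1 : HasMajorantHom (g := toB6 g R H) blk blkY A1 (maj342 g 1 C δ) := by rw [maj342_one]; exact h1
  have hm2 : HasMajorantHom (g := toB6 g R H) blkY blk A2 (maj342 g 2 C δ) := by rw [maj342_two]; exact h2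
  have hm3 : HasMajorantHom (g := toB6 g R H) blk blk A3 (maj342 g 3 C δ) := by rw [maj342_three]; exact h3
  -- (3.42): n06-l's engine, constant m·C at rate δ, merged to (B₀, δ₀)
  have h342C : ∀ n : Fin 4, Clause342 K n (m * C) δ U :=
    clause342_all (clause342_of_hasMajorantHom_rel hco0 hC hlen0 (hsat₁ 0) (hsat₂ 0) hmult hm0)
      (clause342_of_hasMajorantHom_rel hco1 hC hlen0 (hsat₁ 1) (hsat₂ 1) hmult hm1)
      (clause342_of_hasMajorantHom_rel hco2 hC hlen0 (hsat₁ 2) (hsat₂ 2) hmult hm2)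
      (clause342_of_hasMajorantHom_rel hco3 hC hlen0 (hsat₁ 3) (hsat₂ 3) hmult hm3)
  have h342 : ∀ n : Fin 4, Clause342 K n B₀ δ₀ U := fun n =>
    clause342_mono (h342C n) hmC hCB hδ₀' hdnn hlen0 hN
  -- (3.47): the four weighted lines from the sup majorants (no fibre field — unchanged)
  have h347 : ∀ (n : Fin 4) (lam : g.Loc) (γ : ℝ), -4 ≤ γ → γ ≤ 4 → K.glob n U lam γ ≤ B₀ * g.wNorm γ lam := by
    intro n lam γ hγ₁ hγ₂
    have hw : ∀ (hg : 0 ≤ g.wNorm γ lam), K.glob n U lam γ ≤ C * B6.c1 d δ (1 - α) * L₀ ^ (4 : ℝ) * g.wNorm γ lam →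
        K.glob n U lam γ ≤ B₀ * g.wNorm γ lam := fun hg h =>
      h.trans (mul_le_mul_of_nonneg_right hCg hg)
    fin_cases n
    · exact hw (hgl0.wnorm_nonneg lam γ) (glob_of_majorant hF hgl0 hC hm0 lam γ hγ₁ hγ₂)
    · exact hw (hgl1.wnorm_nonneg lam γ) (glob_of_majorant hF hgl1 hC hm1 lam γ hγ₁ hγ₂)
    · exact hw (hgl2.wnorm_nonneg lam γ) (glob_of_majorant hF hgl2 hC hm2 lam γ hγ₁ hγ₂)
    · exact hw (hgl3.wnorm_nonneg lam γ) (glob_of_majorant hF hgl3 hC hm3 lam γ hγ₁ hγ₂)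
  -- (3.46)₀,₁,₂: the Schur block bounds of the sibling at (C·L₀, (1−α)δ), merged to rate δ₀, read on the neighbourhood
  have hmono : ∀ (P : g.Site → ℝ) (c : ℝ), 0 ≤ c → (∀ y, 0 ≤ P y) → ∀ y y' : g.Site,
      c * P y * Real.exp (-((1 - α) * δ * g.dist y y')) ≤ c * P y * Real.exp (-(δ₀ * g.dist y y')) :=
    fun P c hc hP y y' => mul_le_mul_of_nonneg_left (hexp y y') (mul_nonneg hc (hP y))
  have hCL0 : 0 ≤ C * L₀ := mul_nonneg hC hL₀
  have p012 : ∀ t : ℝ, B9.pref6 t 0 = t ^ 2 ∧ B9.pref6 t 1 = t ∧ B9.pref6 t 2 = t := fun t => by simp [B9.pref6]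
  have hb0 : BlockBd (g := toB6 g R H) blk blk A0
      (fun (y y' : g.Site) => C * L₀ * B9.pref6 (g.len y) 0 * Real.exp (-(δ₀ * g.dist y y'))) := by
    refine (blockBd_entry0 hF hC hsymm hlen blk h0 hsym).mono fun y y' => ?_
    rw [(p012 (g.len y)).1]
    exact hmono (fun y => g.len y ^ 2) (C * L₀) hCL0 (fun y => sq_nonneg _) y y'
  have hb1 : BlockBd (g := toB6 g R H) blk blkY A1
      (fun (y y' : g.Site) => C * L₀ * B9.pref6 (g.len y) 1 * Real.exp (-(δ₀ * g.dist y y'))) := by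
    refine (blockBd_entry1 hF hC hsymm hlen blk blkY h1 h2 htr).mono fun y y' => ?_
    rw [(p012 (g.len y)).2.1]
    exact hmono (fun y => g.len y) (C * L₀) hCL0 hlen0 y y'
  have hb2 : BlockBd (g := toB6 g R H) blkY blk A2
      (fun (y y' : g.Site) => C * L₀ * B9.pref6 (g.len y) 2 * Real.exp (-(δ₀ * g.dist y y'))) := by
    refine (blockBd_entry2 hF hC hsymm hlen blk blkY h1 h2 htr).mono fun y y' => ?_
    rw [(p012 (g.len y)).2.2]
    exact hmono (fun y => g.len y) (C * L₀) hCL0 hlen0 y y'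
  have hl20 := l2line_weaken' hCL hlen0 hl0.cutSup_nonneg hl0.l2norm_nonneg
    (l2line_of_blockBd_nbr hl0 hRd₂ hmult hnbr hCL1 hCLcmp htri hsymm hCL0 hδ₀nn hCev hlen0 hb0)
  have hl21 := l2line_weaken' hCL hlen0 hl1.cutSup_nonneg hl1.l2norm_nonneg
    (l2line_of_blockBd_nbr hl1 hRd₂ hmult hnbr hCL1 hCLcmp htri hsymm hCL0 hδ₀nn hCev hlen0 hb1)
  have hl22 := l2line_weaken' hCL hlen0 hl2.cutSup_nonneg hl2.l2norm_nonneg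
    (l2line_of_blockBd_nbr hl2 hRd₂ hmult hnbr hCL1 hCLcmp htri hsymm hCL0 hδ₀nn hCev hlen0 hb2)
  -- (3.46), K-indices 4 and 5: the printed pair families ∇∇G, G∇*∇* as packaged models into X × Q with direct L² block bounds
  have p345 : ∀ t : ℝ, B9.pref6 t 3 = 1 ∧ B9.pref6 t 4 = 1 ∧ B9.pref6 t 5 = 1 := fun t => by simp [B9.pref6]
  have hb4f' : BlockBd (g := toB6 g R H) blk (blk ∘ Prod.fst) A4f
      (fun (y y' : g.Site) => K₃ * B9.pref6 (g.len y) 4 * Real.exp (-(δ₀ * g.dist y y'))) := by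
    refine hb4f.mono fun a b => ?_
    rw [(p345 (g.len a)).2.1, mul_one]
    exact mul_le_mul_of_nonneg_left (hexp2 a b) hK₃
  have hb5' : BlockBd (g := toB6 g R H) blk (blk ∘ Prod.fst) A5f
      (fun (y y' : g.Site) => K₃ * B9.pref6 (g.len y) 5 * Real.exp (-(δ₀ * g.dist y y'))) := by
    refine hb5.mono fun a b => ?_
    rw [(p345 (g.len a)).2.2, mul_one]
    exact mul_le_mul_of_nonneg_left (hexp2 a b) hK₃
  have hl24 := l2line_weaken' hB3 hlen0 hl4.cutSup_nonneg hl4.l2norm_nonneg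
    (l2line_of_blockBd_nbr hl4 hRd₂ hmult hnbr hCL1 hCLcmp htri hsymm hK₃ hδ₀nn hCev hlen0 hb4f')
  have hl25 := l2line_weaken' hB3 hlen0 hl5.cutSup_nonneg hl5.l2norm_nonneg
    (l2line_of_blockBd_nbr hl5 hRd₂ hmult hnbr hCL1 hCLcmp htri hsymm hK₃ hδ₀nn hCev hlen0 hb5')
  -- (3.46), K-index 3: the mixed member ∇G∇* on the pair family, with its L² block bound
  have hb3f' : BlockBd (g := toB6 g R H) blk (blk ∘ Prod.fst) A3f
      (fun (y y' : g.Site) => KM * B9.pref6 (g.len y) 3 * Real.exp (-(δ₀ * g.dist y y'))) := by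
    refine hb3f.mono fun a b => ?_
    rw [(p345 (g.len a)).1, mul_one]
    exact mul_le_mul_of_nonneg_left (hexp2 a b) hKM
  have hl23 := l2line_weaken' hBM hlen0 hl3.cutSup_nonneg hl3.l2norm_nonneg
    (l2line_of_blockBd_nbr hl3 hRd₂ hmult hnbr hCL1 hCLcmp htri hsymm hKM hδ₀nn hCev hlen0 hb3f')
  have h346 := l2lines_of_six' hl20 hl21 hl22 hl23 hl24 hl25
  -- (3.43): the probe majorants at (B_h, δ₀), read on the neighbourhood (×m·CL·e^{rδ₀}), merged to B(β)
  have hLβ : ∀ β, 0 ≤ β → β < 1 → HasMajorantHom (g := toB6 g R H) blk 𝔭.blkPY (𝔭.ΦY U β ∘ₗ A1)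
      (fun (a b : g.Site) => Bh β * g.len a ^ (1 - β) * Real.exp (-(δ₀ * g.dist a b))) := fun β hβ0 hβ1 =>
    probeMaj_mono'' blk 𝔭.blkPY (hH β hβ0 hβ1).1 le_rfl hδ₀' hdnn hlen0 (hBh β hβ0 hβ1)
  have hRβ : ∀ β, 0 ≤ β → β < 1 → HasMajorantHom (g := toB6 g R H) blkY 𝔭.blkPX (𝔭.ΦX U β ∘ₗ A2)
      (fun (a b : g.Site) => Bh β * g.len a ^ (1 - β) * Real.exp (-(δ₀ * g.dist a b))) := fun β hβ0 hβ1 =>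
    probeMaj_mono'' blkY 𝔭.blkPX (hH β hβ0 hβ1).2 le_rfl hδ₀' hdnn hlen0 (hBh β hβ0 hβ1)
  have h343 := line343_weaken' hBβ hlen0 hH1.cutH_nonneg hH1.norm_nonneg
    (line343_of_hasMajorantHom_nbr (R := R) (H := H) hH1 hRd₂ hmult hCL1 hCLcmp htri hsymm hBh hδ₀nn hlen0 hLβ hRβ)
  -- (3.44)∕(3.45): the input majorants merged to rate δ₀, read on the neighbourhood, constants merged to B′(ε), B′(ε,β)
  have h44' : ∀ ε, 0 < ε → ε ≤ 1 → HasMaj (bHX ε) (BlockNorm.ofBlocks (toB6 g R H) (blk ∘ Prod.fst)) A3f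
      (fun (a b : g.Site) => K44 ε * Real.exp (-(δ₀ * g.dist a b))) :=
    fun ε hε0 hε1 => (h44 ε hε0 hε1).mono fun a b => mul_le_mul_of_nonneg_left (hexp a b) (hK44 ε hε0 hε1)
  have h45' : ∀ ε β, 0 < ε → ε ≤ 1 → 0 ≤ β → β < 1 →
      HasMaj (bHX (β + ε)) (BlockNorm.ofBlocks (toB6 g R H) (𝔭.blkPX ∘ Prod.fst)) (sliceProbe (𝔭.ΦX U β) ∘ₗ A3f)
        (fun (a b : g.Site) => K45 ε β * g.len a ^ (-β) * Real.exp (-(δ₀ * g.dist a b))) := by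
    intro ε β hε0 hε1 hβ0 hβ1
    refine (h45 ε β hε0 hε1 hβ0 hβ1).mono fun a b => ?_
    exact mul_le_mul_of_nonneg_left (hexp a b) (mul_nonneg (hK45 ε β hε0 hε1 hβ0 hβ1) (Real.rpow_nonneg (hlen0 a) _))
  obtain ⟨h344K, h345K⟩ := lines3445_of_hasMaj_fam hIR hCL1 hCLcmp htri hsymm hK44 hK45 hδ₀nn hlen h44' h45'
  have h344 := line344_weaken' hBε hIR.hs_nonneg h344K
  have h345 := line345_weaken' hBεβ hlen0 hIR.cutH_nonneg hIR.hs_nonneg h345K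
  exact ⟨ineq342_346_347_of_clauses h342 h346 h347, ineq343_345_of_lines h343 h344 h345⟩

end OneMember

/-! ## §2 ★★ Theorem 3.10 (the sum G(U) of (3.107)) at the all-blocks pin with NO displayed residual, neighbourhood-sited readings -/

section AllPinsG

variable {I : Type} {c35 : ℝ} {geo : I → B9.Geometry} {bg : I → B9.Backgrounds}
variable [∀ i, Fintype (geo i).Site] [∀ i, DecidableEq (geo i).Site]

/-- Arithmetic of «for M sufficiently large»: M ≧ 2N_Fθ₀c₁ gives N_F·θ₀M⁻¹·c₁ ≦ ½ (twin of the siblings' private lemma). [folklore] -/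
private theorem small_of_threshold_pair {NF θ₀ c M : ℝ} (hM : 0 < M) (hbig : 2 * NF * θ₀ * c ≤ M) :
    NF * (θ₀ * M⁻¹) * c ≤ 1 / 2 := by
  have h1 : NF * (θ₀ * M⁻¹) * c = (NF * θ₀ * c) / M := by
    rw [div_eq_mul_inv]
    ring
  rw [h1, div_le_iff₀ hM]
  linarith

/-- ★★ **THEOREM 3.10 AT THE ALL-BLOCKS PIN WITH NO DISPLAYED RESIDUAL, THE (3.43)–(3.46) CO-READINGS SITED ON THE NEIGHBOURHOOD** — p. 416:
*"From (3.108) it follows that the expansion (3.107) is convergent in all norms in the inequalities (3.42)–(3.47). This implies Theorem 3.3."*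
The `Nbr` form of `B9RWSumsAllBlocksRel.thm310Printed_allPin_completeRel` (whose class-sited `L2ReadsRel`∕`H1ReadsRel`∕`InputReadsRel` binders are not
dischargeable at the record's coordinate pins — `B9RWSumsReadsRelNegative.not_l2ReadsRel_evBK`): the leaf `B9.Thm310Printed c35 geo bg (fun i =>
W310OfOps (𝔬 i) (rd i) (ConvAll3107 (𝔬 i) (R i) (H i) C δ (K i) B₀ δ₀ Bβ Bε Bεβ))` from the leaf at the sup-block pin (`h310`) and, per member
and per regular configuration, ONLY operator-level hypothesis schemas of printed shape about the local operators (`HolderLegs310`, `LapLegs310`,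
`InputLegs310`, `L2TwoLegs310`), the elementary factors (`Factors389`, `FactorsHolder310`, `FactorsInput310`, `FactorsL2_310`), the structure
(3.105) (`Identities310`), the static data, the letters, the member facts — and the co-readings of `K i` (`CoRealizesRel` relative to `Rel i` (n06-l),
`GlobReads`, and the NEIGHBOURHOOD-SITED `L2ReadsNbr`, `H1ReadsNbr`, `InputReadsNbr` of radius r) with class multiplicity ≦ m, Lʲη, d saturated
on classes, neighbourhood count ≦ mN, level comparability CL and evaluation constant Cev; the multiplicities are folded into the constants'
relations (m·C ≦ B₀, mN·m·Cev·CL²·e^{rδ₀}·C·L₀ ≦ B₀, mN·m·Cev·CL²·e^{rδ₀}·√(C·lapConst)·L₀ ≦ B₀, mN·m·Cev·CL²·e^{rδ₀}·twoConst ≦ B₀,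
m·CL·e^{rδ₀}·holderConst(β) ≦ B(β), e^{rδ₀}·inputConst44 ≦ B′(ε), CL·e^{rδ₀}·inputConst45 ≦ B′(ε,β)).  Every
member line is PROVED inside through the operator lemmas `holder343_of_local310`, `inputPair3445_family`, `blockBd_mixed_family`,
`blockBd_second_family3∕5`, `blockBd_entry0∕1∕2`, `blockBd_pair_of_transpose` and §1.  Nothing of print asserted; every input is a hypothesis;
NOT a node discharge. [cite: Balaban1985BackgroundPropagators, Thm 3.10 (3.105)–(3.108) pp.414–416 + Thm 3.3 p.399 + (3.42)–(3.47) pp.397–398 + Cor. 3.6 p.408 + p.413; Balaban1984PropagatorsII, (2.51)–(2.52) p.232 + Lemma 2.1 (2.60)–(2.61) p.234] -/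
theorem thm310Printed_allPin_completePairM {X Y ι A PX PY Q : I → Type} [∀ i, Fintype (X i)] [∀ i, DecidableEq (X i)]
    [∀ i, Fintype (Y i)] [∀ i, DecidableEq (Y i)] [∀ i, Fintype (ι i)] [∀ i, Fintype (A i)] [∀ i, Fintype (PX i)]
    [∀ i, DecidableEq (PX i)] [∀ i, Fintype (PY i)] [∀ i, DecidableEq (PY i)] [∀ i, Fintype (Q i)]
    {𝔬 : ∀ i, Ops310 (geo i) (bg i) (X i) (Y i) (ι i) (A i)}
    {rd : ∀ i, WalkReading310 (geo i) (bg i) (X i) (ι i) (A i)} {R : I → ℝ} {H : I → Prop} {C δ : ℝ}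
    (𝔭 : ∀ i, HolderProbes (geo i) (bg i) (X i) (Y i) (PX i) (PY i)) (𝔡 : ∀ i, DirOps310 (𝔬 i) (Q i))
    (bHX : ∀ i, ℝ → BlockNorm (toB6 (geo i) (R i) (H i)) (X i → ℝ))
    (K : ∀ i, B9.KernelFamily (geo i) (bg i)) (ev : ∀ i, (geo i).Loc → X i → ℝ) (evY : ∀ i, (geo i).Loc → Y i → ℝ)
    (Rel : ∀ i, (geo i).Site → (geo i).Site → Prop) [∀ i, DecidableRel (Rel i)] (m : ℕ) (r Cev CL : ℝ) (mN : ℕ)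
    {d : ℕ} {α L₀ B₀ δ₀ Mg : ℝ} {Bβ Bε : ℝ → ℝ} {Bεβ : ℝ → ℝ → ℝ}
    (κ : I → Sizes310) (SH : ∀ i, ι i → Finset (geo i).Site) (Bl θH : ℝ → ℝ) (d₁ : ℕ)
    (δ₁ α₁ ρ N N' NF Cℓ θ₀ NH a₁ M₁ ML : ℝ)
    (S3 : ∀ i, ι i → Finset (geo i).Site) (N3 B3 θ3 NQ : ℝ)
    (SI : ∀ i, ι i → Finset (geo i).Site) (NI : ℝ) (BI θI : ℝ → ℝ) (BI2 : ℝ → ℝ → ℝ)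
    (SM : ∀ i, ι i → Finset (geo i).Site) (NM BM θM : ℝ)
    (h310 : B9.Thm310Printed c35 geo bg (fun i => W310OfOps (𝔬 i) (rd i) (Conv3107 (𝔬 i) (R i) (H i) C δ)))
    (hRlen : ∀ i (a a' : (geo i).Site), Rel i a a' → (geo i).len a = (geo i).len a')
    (hRd₁ : ∀ i (a a' b : (geo i).Site), Rel i a a' → (geo i).dist a b = (geo i).dist a' b)
    (hRd₂ : ∀ i (a b b' : (geo i).Site), Rel i b b' → (geo i).dist a b = (geo i).dist a b')
    (hmult : ∀ i (y' : (geo i).Site), (Finset.univ.filter (fun y'' => Rel i y'' y')).card ≤ m)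
    (hnbr : ∀ i (y : (geo i).Site), (nbr (geo i) r y).card ≤ mN) (hCL1 : 1 ≤ CL)
    (hCLcmp : ∀ i (a a' : (geo i).Site), (geo i).dist a a' ≤ r → (geo i).len a ≤ CL * (geo i).len a')
    (htri : ∀ i (a b c : (geo i).Site), (geo i).dist a c ≤ (geo i).dist a b + (geo i).dist b c) (hCev : 0 ≤ Cev)
    (hco0 : ∀ i U, CoRealizesRel (K i) 0 U (Rel i) (𝔬 i).blk (𝔬 i).blk (ev i) ((𝔬 i).G U))
    (hco1 : ∀ i U, CoRealizesRel (K i) 1 U (Rel i) (𝔬 i).blkY (𝔬 i).blk (ev i) ((𝔬 i).D U ∘ₗ (𝔬 i).G U))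
    (hco2 : ∀ i U, CoRealizesRel (K i) 2 U (Rel i) (𝔬 i).blk (𝔬 i).blkY (evY i) ((𝔬 i).G U ∘ₗ (𝔬 i).Dstar U))
    (hco3 : ∀ i U, CoRealizesRel (K i) 3 U (Rel i) (𝔬 i).blk (𝔬 i).blk (ev i) ((𝔬 i).Lap U ∘ₗ (𝔬 i).G U))
    (hgl0 : ∀ i U, GlobReads (K i) 0 U (𝔬 i).blk (𝔬 i).blk (ev i) ((𝔬 i).G U))
    (hgl1 : ∀ i U, GlobReads (K i) 1 U (𝔬 i).blkY (𝔬 i).blk (ev i) ((𝔬 i).D U ∘ₗ (𝔬 i).G U))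
    (hgl2 : ∀ i U, GlobReads (K i) 2 U (𝔬 i).blk (𝔬 i).blkY (evY i) ((𝔬 i).G U ∘ₗ (𝔬 i).Dstar U))
    (hgl3 : ∀ i U, GlobReads (K i) 3 U (𝔬 i).blk (𝔬 i).blk (ev i) ((𝔬 i).Lap U ∘ₗ (𝔬 i).G U))
    (hl0 : ∀ i U, L2ReadsNbr (R := R i) (H := H i) (K i) 0 U (Rel i) r Cev (𝔬 i).blk (𝔬 i).blk (ev i) ((𝔬 i).G U))
    (hl1 : ∀ i U, L2ReadsNbr (R := R i) (H := H i) (K i) 1 U (Rel i) r Cev (𝔬 i).blkY (𝔬 i).blk (ev i) ((𝔬 i).D U ∘ₗ (𝔬 i).G U))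
    (hl2 : ∀ i U, L2ReadsNbr (R := R i) (H := H i) (K i) 2 U (Rel i) r Cev (𝔬 i).blk (𝔬 i).blkY (evY i)
      ((𝔬 i).G U ∘ₗ (𝔬 i).Dstar U))
    (hl3 : ∀ i U, L2ReadsNbr (R := R i) (H := H i) (K i) 3 U (Rel i) r Cev ((𝔬 i).blk ∘ Prod.fst) (𝔬 i).blk (ev i)
      (familyOp fun p : Q i × Q i => (𝔡 i).Dd U p.1 ∘ₗ ((𝔬 i).G U ∘ₗ (𝔡 i).Dsd U p.2)))
    (hl4 : ∀ i U, L2ReadsNbr (R := R i) (H := H i) (K i) 4 U (Rel i) r Cev ((𝔬 i).blk ∘ Prod.fst) (𝔬 i).blk (ev i)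
      (familyOp fun p : Q i × Q i => ((𝔡 i).Dd U p.1 ∘ₗ (𝔡 i).Dd U p.2) ∘ₗ (𝔬 i).G U))
    (hl5 : ∀ i U, L2ReadsNbr (R := R i) (H := H i) (K i) 5 U (Rel i) r Cev ((𝔬 i).blk ∘ Prod.fst) (𝔬 i).blk (ev i)
      (familyOp fun p : Q i × Q i => (𝔬 i).G U ∘ₗ ((𝔡 i).Dsd U p.1 ∘ₗ (𝔡 i).Dsd U p.2)))
    (hH1 : ∀ i U, H1ReadsNbr (K i) U (𝔭 i) (Rel i) r (𝔬 i).blk (𝔬 i).blkY (ev i) (evY i) ((𝔬 i).D U ∘ₗ (𝔬 i).G U)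
      ((𝔬 i).G U ∘ₗ (𝔬 i).Dstar U))
    (hIR : ∀ i U, InputReadsFam (K i) U (bHX i) r ((𝔬 i).blk ∘ Prod.fst) ((𝔭 i).blkPX ∘ Prod.fst)
      (fun β => sliceProbe ((𝔭 i).ΦX U β)) (ev i)
      (familyOp fun p : Q i × Q i => (𝔡 i).Dd U p.1 ∘ₗ ((𝔬 i).G U ∘ₗ (𝔡 i).Dsd U p.2)))
    (hsym : ∀ i, M₁ ≤ (geo i).M → ∀ α₀ : ℝ, 0 < α₀ → c35 * (geo i).M * α₀ ≤ a₁ →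
      ∀ U : (bg i).Cfg, (bg i).Reg335 c35 α₀ U → IsTransposePair ((𝔬 i).G U) ((𝔬 i).G U))
    (htr : ∀ i, M₁ ≤ (geo i).M → ∀ α₀ : ℝ, 0 < α₀ → c35 * (geo i).M * α₀ ≤ a₁ →
      ∀ U : (bg i).Cfg, (bg i).Reg335 c35 α₀ U → IsTransposePair ((𝔬 i).D U ∘ₗ (𝔬 i).G U) ((𝔬 i).G U ∘ₗ (𝔬 i).Dstar U))
    (hfacts : ∀ i, Mg ≤ (geo i).M → Facts347 (geo i) (R i) (H i) d δ α L₀)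
    (hdsymm : ∀ i (a b : (geo i).Site), (geo i).dist a b = (geo i).dist b a)
    (hC : 0 ≤ C) (hCB : (m : ℝ) * C ≤ B₀) (hCL : (mN : ℝ) * m * Cev * CL ^ 2 * Real.exp (r * δ₀) * (C * L₀) ≤ B₀)
    (hδ₀nn : 0 ≤ δ₀) (hδ₀ : δ₀ ≤ (1 - α) * δ)
    (hδ₀2 : δ₀ ≤ (1 - 2 * α) * δ) (hα : 0 ≤ α * δ) (hα2 : 2 * α * δ ≤ δ) (hCg : C * B6.c1 d δ (1 - α) * L₀ ^ (4 : ℝ) ≤ B₀)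
    (hc : 0 < c35) (ha₁ : 0 < a₁) (hα₁ : 0 ≤ α₁) (hα₁2 : α₁ ≤ 1 / 2) (hNF : 0 ≤ NF) (hθ₀ : 0 ≤ θ₀) (hNH : 0 ≤ NH)
    (hδnn : 0 ≤ δ) (hδ5 : δ ≤ (1 - 2 * α₁) * δ₁) (hδ₁ : 0 ≤ δ₁) (hN3 : 0 ≤ N3) (hB3 : 0 ≤ B3) (hθ3 : 0 ≤ θ3) (hNI : 0 ≤ NI)
    (hNM : 0 ≤ NM) (hBM : 0 ≤ BM) (hθM : 0 ≤ θM)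
    (hB35 : (mN : ℝ) * m * Cev * CL ^ 2 * Real.exp (r * δ₀) * (NQ * secondConst d₁ δ₁ α₁ N3 B3 NF θ3 C L₀) ≤ B₀)
    (hB3M : (mN : ℝ) * m * Cev * CL ^ 2 * Real.exp (r * δ₀) * (NQ * mixedConst d₁ δ₁ α₁ NM BM NF θM C L₀) ≤ B₀)
    (hst : ∀ i, StaticOK310 (𝔬 i) ρ N N' NF Cℓ (κ i))
    (hcntH : ∀ i (a : (geo i).Site), (∑ q, if a ∈ SH i q then (1 : ℝ) else 0) ≤ NH)
    (hcnt3 : ∀ i (a : (geo i).Site), (∑ q, if a ∈ S3 i q then (1 : ℝ) else 0) ≤ N3)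
    (hNQ : ∀ i, (Fintype.card (Q i) : ℝ) ≤ NQ)
    (hcntI : ∀ i (a : (geo i).Site), (∑ q, if a ∈ SI i q then (1 : ℝ) else 0) ≤ NI)
    (hcntM : ∀ i (a : (geo i).Site), (∑ q, if a ∈ SM i q then (1 : ℝ) else 0) ≤ NM)
    (hBl : ∀ β, 0 ≤ β → β < 1 → 0 ≤ Bl β) (hθH : ∀ β, 0 ≤ β → β < 1 → 0 ≤ θH β)
    (hBI : ∀ ε, 0 < ε → ε ≤ 1 → 0 ≤ BI ε) (hBI2 : ∀ ε β, 0 < ε → ε ≤ 1 → 0 ≤ β → β < 1 → 0 ≤ BI2 ε β)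
    (hθI : ∀ ε, 0 < ε → 0 ≤ θI ε)
    (hBβ : ∀ β, 0 ≤ β → β < 1 → (m : ℝ) * CL * Real.exp (r * δ₀) * holderConst d₁ δ₁ α₁ NH NF C (Bl β) (θH β) ≤ Bβ β)
    (hBε : ∀ ε, 0 < ε → ε ≤ 1 → Real.exp (r * δ₀) * inputConst44 d₁ δ₁ α₁ NI NF C L₀ (BI ε) (θI ε) ≤ Bε ε)
    (hBεβ : ∀ ε β, 0 < ε → ε ≤ 1 → 0 ≤ β → β < 1 →
      CL * Real.exp (r * δ₀) *
        inputConst45 d₁ δ₁ α₁ NI NF L₀ (holderConst d₁ δ₁ α₁ NH NF C (Bl β) (θH β)) (BI2 ε β) (θI (β + ε)) ≤ Bεβ ε β)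
    (h261 : ∀ i, ML ≤ (geo i).M → Ineq261 d₁ (toB6 (geo i) (R i) (H i)) δ₁ α₁)
    (hop : ∀ i, M₁ ≤ (geo i).M → ∀ α₀ : ℝ, 0 < α₀ → c35 * (geo i).M * α₀ ≤ a₁ →
      ∀ U : (bg i).Cfg, (bg i).Reg335 c35 α₀ U →
        Factors389 (𝔬 i) (R i) (H i) θ₀ δ₁ U ∧ Identities310 (𝔬 i) (R i) (H i) U ∧
          HolderLegs310 (𝔬 i) (𝔭 i) (R i) (H i) (SH i) Bl δ₁ U ∧ FactorsHolder310 (𝔬 i) (𝔭 i) (R i) (H i) θH δ₁ U)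
    (hop3 : ∀ i, M₁ ≤ (geo i).M → ∀ α₀ : ℝ, 0 < α₀ → c35 * (geo i).M * α₀ ≤ a₁ →
      ∀ U : (bg i).Cfg, (bg i).Reg335 c35 α₀ U →
        L2SecondLegs310 (𝔬 i) (𝔡 i) (R i) (H i) (S3 i) B3 δ₁ U ∧ FactorsL2Second310 (𝔬 i) (𝔡 i) (R i) (H i) θ3 δ₁ U ∧
          DirTranspose310 (𝔬 i) (𝔡 i) U)
    (hopI : ∀ i, M₁ ≤ (geo i).M → ∀ α₀ : ℝ, 0 < α₀ → c35 * (geo i).M * α₀ ≤ a₁ →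
      ∀ U : (bg i).Cfg, (bg i).Reg335 c35 α₀ U →
        InputLegsPair310 (𝔬 i) (𝔡 i) (𝔭 i) (R i) (H i) (bHX i) (SI i) BI BI2 δ₁ U ∧
          FactorsInputPair310 (𝔬 i) (𝔡 i) (R i) (H i) (bHX i) θI δ₁ U ∧ DirSupHolder310 (𝔬 i) (𝔡 i) (𝔭 i) (R i) (H i) U)
    (hopM : ∀ i, M₁ ≤ (geo i).M → ∀ α₀ : ℝ, 0 < α₀ → c35 * (geo i).M * α₀ ≤ a₁ →
      ∀ U : (bg i).Cfg, (bg i).Reg335 c35 α₀ U →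
        L2MixedLegs310 (𝔬 i) (𝔡 i) (R i) (H i) (SM i) BM δ₁ U ∧ FactorsL2Mixed310 (𝔬 i) (𝔡 i) (R i) (H i) θM δ₁ U ∧
          DirSup310 (𝔬 i) (𝔡 i) (R i) (H i) U) :
    B9.Thm310Printed c35 geo bg
      (fun i => W310OfOps (𝔬 i) (rd i) (ConvAll3107 (𝔬 i) (R i) (H i) C δ (K i) B₀ δ₀ Bβ Bε Bεβ)) := by
  have hαδ₁ : 0 ≤ α₁ * δ₁ := mul_nonneg hα₁ hδ₁
  have hrate : (1 - 2 * α) * δ ≤ (1 - α₁) * δ₁ := by nlinarith [hα, hδ5, hαδ₁]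
  have hδδ₁ : δ ≤ (1 - α₁) * δ₁ := hδ5.trans (by nlinarith [hαδ₁])
  have hα₁1 : α₁ ≤ 1 := by linarith
  have hαδ1 : α * δ ≤ δ := by linarith
  have hc1 : 0 ≤ B6.c1 d₁ δ₁ α₁ := c1_nonneg d₁ δ₁ α₁
  set Mbig : ℝ := 2 * NF * θ₀ * B6.c1 d₁ δ₁ α₁ with hMbig
  refine thm310Printed_W310OfOps_strengthen h310 (max (max Mg 1) (max (max M₁ ML) (max M₁ Mbig))) (a₁ / c35)
    (div_pos ha₁ hc) fun i hM α₀ hα₀ hMa U hU hconv => ?_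
  have hMg : Mg ≤ (geo i).M := le_trans (le_trans (le_max_left _ _) (le_max_left _ _)) hM
  have hM1 : 1 ≤ (geo i).M := le_trans (le_trans (le_max_right _ _) (le_max_left _ _)) hM
  have hM₁i : M₁ ≤ (geo i).M := le_trans (le_trans (le_trans (le_max_left _ _) (le_max_left _ _)) (le_max_right _ _)) hM
  have hMLi : ML ≤ (geo i).M := le_trans (le_trans (le_trans (le_max_right _ _) (le_max_left _ _)) (le_max_right _ _)) hM
  have hMb : Mbig ≤ (geo i).M := le_trans (le_trans (le_trans (le_max_right _ _) (le_max_right _ _)) (le_max_right _ _)) hM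
  have hMpos : 0 < (geo i).M := lt_of_lt_of_le one_pos hM1
  have ha : c35 * (geo i).M * α₀ ≤ a₁ := by
    have h1 : (geo i).M * α₀ * c35 ≤ a₁ := (le_div_iff₀ hc).mp hMa
    calc c35 * (geo i).M * α₀ = (geo i).M * α₀ * c35 := by ring
      _ ≤ a₁ := h1
  obtain ⟨h0, h1, h2, h3⟩ := hconv
  obtain ⟨hf, hi, hL, hFH⟩ := hop i hM₁i α₀ hα₀ ha U hU
  obtain ⟨hL3, hFL3, hDT⟩ := hop3 i hM₁i α₀ hα₀ ha U hU
  obtain ⟨hIL, hFI, hDH⟩ := hopI i hM₁i α₀ hα₀ ha U hU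
  obtain ⟨hLM, hFLM, hDS⟩ := hopM i hM₁i α₀ hα₀ ha U hU
  have hq : NF * (θ₀ * ((geo i).M)⁻¹) * B6.c1 d₁ δ₁ α₁ ≤ 1 / 2 :=
    small_of_threshold_pair hMpos (by rw [hMbig] at hMb; exact hMb)
  have hF := hfacts i hMg
  have hL₀ : 0 ≤ L₀ := le_trans (le_trans zero_le_one hF.one_le_L) hF.L_le
  have hlen : ∀ y : (geo i).Site, 0 < (geo i).len y := (hst i).lenpos
  -- the operator-level majorants of the members (3.43), (3.46) K-indices 4∕5 (pair families), (3.44)∕(3.45), (3.46) K-index 3 (mixed)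
  have hH := holder343_of_local310 (𝔬 i) (𝔭 i) (R i) (H i) d₁ δ₁ α₁ ρ N N' NF Cℓ θ₀ NH C δ (κ i) (SH i) Bl θH U hδ₁ hα₁
    hα₁1 hNF hθ₀ hNH hM1 hC hδnn hδδ₁ (hst i) (hcntH i) hBl hθH (h261 i hMLi) hq hf hi hL hFH h2
  have hH' : ∀ β : ℝ, 0 ≤ β → β < 1 →
      HasMajorantHom (g := toB6 (geo i) (R i) (H i)) (𝔬 i).blk (𝔭 i).blkPY ((𝔭 i).ΦY U β ∘ₗ ((𝔬 i).D U ∘ₗ (𝔬 i).G U))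
          (fun (a b : (geo i).Site) => holderConst d₁ δ₁ α₁ NH NF C (Bl β) (θH β) * (geo i).len a ^ (1 - β) *
            Real.exp (-(δ * (geo i).dist a b))) ∧
        HasMajorantHom (g := toB6 (geo i) (R i) (H i)) (𝔬 i).blkY (𝔭 i).blkPX ((𝔭 i).ΦX U β ∘ₗ ((𝔬 i).G U ∘ₗ (𝔬 i).Dstar U))
          (fun (a b : (geo i).Site) => holderConst d₁ δ₁ α₁ NH NF C (Bl β) (θH β) * (geo i).len a ^ (1 - β) *
            Real.exp (-(δ * (geo i).dist a b))) := by
    intro β hβ0 hβ1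
    have h := hH β hβ0 hβ1
    rw [LinearMap.comp_assoc] at h
    exact h
  have hK2 : 0 ≤ secondConst d₁ δ₁ α₁ N3 B3 NF θ3 C L₀ := secondConst_nonneg hN3 hB3 hNF hθ3 hC hL₀
  have hwk : ∀ a b : (geo i).Site, (Fintype.card (Q i) : ℝ) * secondConst d₁ δ₁ α₁ N3 B3 NF θ3 C L₀ *
      Real.exp (-((1 - 2 * α) * δ * (geo i).dist a b)) ≤ NQ * secondConst d₁ δ₁ α₁ N3 B3 NF θ3 C L₀ *
      Real.exp (-((1 - 2 * α) * δ * (geo i).dist a b)) := fun a b =>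
    mul_le_mul_of_nonneg_right (mul_le_mul_of_nonneg_right (hNQ i) hK2) (Real.exp_nonneg _)
  have hb4f := (blockBd_second_family3 (𝔬 i) (𝔡 i) (R i) (H i) d d₁ δ α L₀ δ₁ α₁ ρ N N' NF Cℓ N3 B3 θ3 C (κ i) (S3 i) U hNF hN3
    hB3 hθ3 hM1 hC hα2 hαδ₁ hrate (hst i) (hcnt3 i) (h261 i hMLi) hF hi hL3 hFL3 hDT h0 (hsym i hM₁i α₀ hα₀ ha U hU)).mono hwk
  have hb5 := (blockBd_second_family5 (𝔬 i) (𝔡 i) (R i) (H i) d d₁ δ α L₀ δ₁ α₁ ρ N N' NF Cℓ N3 B3 θ3 C (κ i) (S3 i) U hNF hN3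
    hB3 hθ3 hM1 hC hα2 hαδ₁ hrate (hst i) (hcnt3 i) (h261 i hMLi) hF hi hL3 hFL3 h0 (hsym i hM₁i α₀ hα₀ ha U hU)).mono hwk
  -- the nonnegativity of the Hölder constant; the mixed family's L² bound and its (3.44)∕(3.45) majorants (sliced probes)
  have hK0 : ∀ β, 0 ≤ β → β < 1 → 0 ≤ holderConst d₁ δ₁ α₁ NH NF C (Bl β) (θH β) := by
    intro β hβ0 hβ1
    have hb := hBl β hβ0 hβ1
    have ht := hθH β hβ0 hβ1
    unfold holderConst
    positivity
  obtain ⟨h44, h45⟩ := inputPair3445_family (𝔬 i) (𝔡 i) (𝔭 i) (R i) (H i) (bHX i) d d₁ δ α L₀ δ₁ α₁ ρ N N' NF Cℓ NI C (κ i)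
    (SI i) (fun β => holderConst d₁ δ₁ α₁ NH NF C (Bl β) (θH β)) BI θI BI2 U hδ₁ hα₁ hNF hNI hM1 hC hδδ₁ hα hαδ1 (hst i)
    (hcntI i) hK0 hBI hBI2 hθI (h261 i hMLi) hF hi hIL hFI hDS hDH h1 (fun β hβ0 hβ1 => (hH β hβ0 hβ1).1)
  have hKM : 0 ≤ mixedConst d₁ δ₁ α₁ NM BM NF θM C L₀ := mixedConst_nonneg hNM hBM hNF hθM hC hL₀
  have hwkM : ∀ a b : (geo i).Site, (Fintype.card (Q i) : ℝ) * mixedConst d₁ δ₁ α₁ NM BM NF θM C L₀ *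
      Real.exp (-((1 - 2 * α) * δ * (geo i).dist a b)) ≤ NQ * mixedConst d₁ δ₁ α₁ NM BM NF θM C L₀ *
      Real.exp (-((1 - 2 * α) * δ * (geo i).dist a b)) := fun a b =>
    mul_le_mul_of_nonneg_right (mul_le_mul_of_nonneg_right (hNQ i) hKM) (Real.exp_nonneg _)
  have hb3f := (blockBd_mixed_family (𝔬 i) (𝔡 i) (R i) (H i) d d₁ δ α L₀ δ₁ α₁ ρ N N' NF Cℓ NM BM θM C (κ i) (SM i) U hNF hNM
    hBM hθM hM1 hC hα2 hαδ₁ hrate (hst i) (hcntM i) (h261 i hMLi) hF hi hLM hFLM hDS hDT h1 h2 (hsym i hM₁i α₀ hα₀ ha U hU)).mono hwkM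
  -- the nonnegativity of the operator-level constants
  have hK35 : 0 ≤ NQ * secondConst d₁ δ₁ α₁ N3 B3 NF θ3 C L₀ :=
    mul_nonneg ((Nat.cast_nonneg _).trans (hNQ i)) hK2
  have hK3M : 0 ≤ NQ * mixedConst d₁ δ₁ α₁ NM BM NF θM C L₀ :=
    mul_nonneg ((Nat.cast_nonneg _).trans (hNQ i)) hKM
  have hK44 : ∀ ε, 0 < ε → ε ≤ 1 → 0 ≤ inputConst44 d₁ δ₁ α₁ NI NF C L₀ (BI ε) (θI ε) := by
    intro ε hε0 hε1
    have hb := hBI ε hε0 hε1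
    have ht := hθI ε hε0
    unfold inputConst44
    positivity
  have hK45 : ∀ ε β, 0 < ε → ε ≤ 1 → 0 ≤ β → β < 1 →
      0 ≤ inputConst45 d₁ δ₁ α₁ NI NF L₀ (holderConst d₁ δ₁ α₁ NH NF C (Bl β) (θH β)) (BI2 ε β) (θI (β + ε)) := by
    intro ε β hε0 hε1 hβ0 hβ1
    have hb := hBI2 ε β hε0 hε1 hβ0 hβ1
    have ht := hθI (β + ε) (by linarith)
    have hh := hK0 β hβ0 hβ1
    unfold inputConst45
    positivity
  exact ⟨⟨h0, h1, h2, h3⟩, allIneqs_of_majorants_pairM (R := R i) (H := H i) (𝔭 i) (bHX i) (𝔬 i).blk (𝔬 i).blkY (ev i) (evY i)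
    (Rel i) m r Cev CL mN (hRlen i) (hRd₁ i) (hRd₂ i) (hmult i) (hnbr i) hCL1 (hCLcmp i) (htri i) hCev h0 h1 h2 h3 hH'
    hb3f hb4f hb5 h44 h45 (hsym i hM₁i α₀ hα₀ ha U hU) (htr i hM₁i α₀ hα₀ ha U hU)
    (hco0 i U) (hco1 i U) (hco2 i U) (hco3 i U) (hgl0 i U) (hgl1 i U) (hgl2 i U) (hgl3 i U) (hl0 i U) (hl1 i U) (hl2 i U)
    (hl3 i U) (hl4 i U) (hl5 i U) (hH1 i U) (hIR i U) hF (hdsymm i) (hst i).dnn hlen hC hK35 hK3M hK0 hK44 hK45 hα hδ₀nn hδ₀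
    hδ₀2 hCB hCg hCL hB35 hB3M hBβ hBε hBεβ⟩

end AllPinsG

/-! ## §3 ★★ Theorem 3.7 (the sum G′(U) of (3.90)) at the all-blocks pin with NO displayed residual, neighbourhood-sited readings -/

section AllPinsGp

variable {I : Type} {c35 : ℝ} {geo : I → B9.Geometry} {bg : I → B9.Backgrounds}
variable [∀ i, Fintype (geo i).Site] [∀ i, DecidableEq (geo i).Site]

/-- Arithmetic of «for M sufficiently large»: a size s ≦ θ₀M⁻¹ and M ≧ 2N′B₁e^{δ₁ρ}θ₀c₁ give N′B₁e^{δ₁ρ}sc₁ ≦ ½ (twin of the siblings'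
private lemma). [folklore] -/
private theorem small_of_size_pair {N' B₀ ex s θ₀ c M : ℝ} (hN' : 0 ≤ N') (hB : 0 ≤ B₀ * ex) (hc : 0 ≤ c) (hM : 0 < M)
    (hs : s ≤ θ₀ * M⁻¹) (hbig : 2 * N' * (B₀ * ex * θ₀) * c ≤ M) : N' * (B₀ * ex * s) * c ≤ 1 / 2 := by
  have h1 : N' * (B₀ * ex * s) * c ≤ N' * (B₀ * ex * (θ₀ * M⁻¹)) * c :=
    mul_le_mul_of_nonneg_right (mul_le_mul_of_nonneg_left (mul_le_mul_of_nonneg_left hs hB) hN') hc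
  have h2 : N' * (B₀ * ex * (θ₀ * M⁻¹)) * c = (N' * (B₀ * ex * θ₀) * c) / M := by
    rw [div_eq_mul_inv]
    ring
  have h3 : (N' * (B₀ * ex * θ₀) * c) / M ≤ 1 / 2 := by
    rw [div_le_iff₀ hM]
    linarith
  exact h1.trans (h2.le.trans h3)

/-- ★★ **THEOREM 3.7 AT THE ALL-BLOCKS PIN WITH NO DISPLAYED RESIDUAL, THE (3.43)–(3.46) CO-READINGS SITED ON THE NEIGHBOURHOOD** — p. 409:
*"The expansion is convergent in all norms appearing in the inequalities (3.42)–(3.47)"*; p. 410: *"Theorem 3.7 implies that all the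
inequalities (3.42)–(3.47) hold for G′"*.  The `Nbr` form of `B9RWSumsAllBlocksRel.thm37Printed_allPin_completeRel`: the leaf `B9.Thm37Printed c35 geo bg
(fun i => E37AllOfOps (𝔴 i) (𝔬 i) (R i) (H i) C δ (K i) B₀ δ₀ Bβ Bε Bεβ)` from n06-c's leaf at the sup-block pin (`h37`) and, per member and per
regular configuration, ONLY operator-level hypothesis schemas about the local operators G′_□(U) (`Local342`, `HolderLegs37`, `HolderV37`, `LapLegs37`,
`InputLegs37`, `L2TwoLegs37`), the elementary factors (`FactorsInput37`, `FactorsL2_37`), the structure (3.88) (`Identities`), the static data and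
sizes, the letters, the member facts — and the co-readings of `K i` (`CoRealizesRel` relative to `Rel i`, `GlobReads`, and the neighbourhood-sited
`L2ReadsNbr`, `H1ReadsNbr`, `InputReadsNbr` of radius r) with class multiplicity ≦ m, neighbourhood count ≦ mN, level comparability CL and
evaluation constant Cev folded into the constants' relations.  Every member
line PROVED inside through `holder343_of_local37`, `inputPair3445_family_37`, `blockBd_mixed_family_37`, `blockBd_second_family3∕5_37`, `blockBd_entry0∕1∕2`,
`blockBd_pair_of_transpose` and §1.  Nothing of print asserted; every input is a hypothesis; NOT a node discharge.
[cite: Balaban1985BackgroundPropagators, Thm 3.7 (3.88)–(3.90) p.409 + Thm 3.7 ⇒ Thm 3.1 p.410 + (3.42)–(3.47) pp.397–398 + Cor. 3.6 p.408; Balaban1984PropagatorsII, (2.51)–(2.52) p.232 + Lemma 2.1 (2.60)–(2.61) p.234] -/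
theorem thm37Printed_allPin_completePairM {X Y ι PX PY Q : I → Type} [∀ i, Fintype (X i)] [∀ i, DecidableEq (X i)]
    [∀ i, Fintype (Y i)] [∀ i, DecidableEq (Y i)] [∀ i, Fintype (ι i)] [∀ i, Fintype (PX i)] [∀ i, DecidableEq (PX i)]
    [∀ i, Fintype (PY i)] [∀ i, DecidableEq (PY i)] [∀ i, Fintype (Q i)]
    {𝔴 : ∀ i, B9.RWExpansion (geo i) (bg i)} {𝔬 : ∀ i, Ops (geo i) (bg i) (X i) (Y i) (ι i)}
    {R : I → ℝ} {H : I → Prop} {C δ : ℝ}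
    (𝔭 : ∀ i, HolderProbes (geo i) (bg i) (X i) (Y i) (PX i) (PY i)) (𝔡 : ∀ i, DirOps37 (𝔬 i) (Q i))
    (bHX : ∀ i, ℝ → BlockNorm (toB6 (geo i) (R i) (H i)) (X i → ℝ))
    (K : ∀ i, B9.KernelFamily (geo i) (bg i)) (ev : ∀ i, (geo i).Loc → X i → ℝ) (evY : ∀ i, (geo i).Loc → Y i → ℝ)
    (Rel : ∀ i, (geo i).Site → (geo i).Site → Prop) [∀ i, DecidableRel (Rel i)] (m : ℕ) (r Cev CL : ℝ) (mN : ℕ)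
    {d : ℕ} {α L₀ B₀ δ₀ Mg : ℝ} {Bβ Bε : ℝ → ℝ} {Bεβ : ℝ → ℝ → ℝ}
    (κ : I → Sizes) (SH : ∀ i, ι i → Finset (geo i).Site) (Bl BV : ℝ → ℝ) (d₁ : ℕ)
    (δ₁ α₁ ρ N N' Cℓ Kc θ₀ B₁ NH a₁ M₁ ML : ℝ)
    (S3 : ∀ i, ι i → Finset (geo i).Site) (N3 B3 θ3 NQ : ℝ)
    (SI : ∀ i, ι i → Finset (geo i).Site) (NI : ℝ) (BI θI : ℝ → ℝ) (BI2 : ℝ → ℝ → ℝ)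
    (SM : ∀ i, ι i → Finset (geo i).Site) (NM BM θM : ℝ)
    (h37 : B9.Thm37Printed c35 geo bg (fun i => E37OfOps (𝔴 i) (𝔬 i) (R i) (H i) C δ))
    (hRlen : ∀ i (a a' : (geo i).Site), Rel i a a' → (geo i).len a = (geo i).len a')
    (hRd₁ : ∀ i (a a' b : (geo i).Site), Rel i a a' → (geo i).dist a b = (geo i).dist a' b)
    (hRd₂ : ∀ i (a b b' : (geo i).Site), Rel i b b' → (geo i).dist a b = (geo i).dist a b')
    (hmult : ∀ i (y' : (geo i).Site), (Finset.univ.filter (fun y'' => Rel i y'' y')).card ≤ m)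
    (hnbr : ∀ i (y : (geo i).Site), (nbr (geo i) r y).card ≤ mN) (hCL1 : 1 ≤ CL)
    (hCLcmp : ∀ i (a a' : (geo i).Site), (geo i).dist a a' ≤ r → (geo i).len a ≤ CL * (geo i).len a')
    (htri : ∀ i (a b c : (geo i).Site), (geo i).dist a c ≤ (geo i).dist a b + (geo i).dist b c) (hCev : 0 ≤ Cev)
    (hco0 : ∀ i U, CoRealizesRel (K i) 0 U (Rel i) (𝔬 i).blk (𝔬 i).blk (ev i) ((𝔬 i).Gp U))
    (hco1 : ∀ i U, CoRealizesRel (K i) 1 U (Rel i) (𝔬 i).blkY (𝔬 i).blk (ev i) ((𝔬 i).D U ∘ₗ (𝔬 i).Gp U))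
    (hco2 : ∀ i U, CoRealizesRel (K i) 2 U (Rel i) (𝔬 i).blk (𝔬 i).blkY (evY i) ((𝔬 i).Gp U ∘ₗ (𝔬 i).Dstar U))
    (hco3 : ∀ i U, CoRealizesRel (K i) 3 U (Rel i) (𝔬 i).blk (𝔬 i).blk (ev i) ((𝔬 i).Lap U ∘ₗ (𝔬 i).Gp U))
    (hgl0 : ∀ i U, GlobReads (K i) 0 U (𝔬 i).blk (𝔬 i).blk (ev i) ((𝔬 i).Gp U))
    (hgl1 : ∀ i U, GlobReads (K i) 1 U (𝔬 i).blkY (𝔬 i).blk (ev i) ((𝔬 i).D U ∘ₗ (𝔬 i).Gp U))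
    (hgl2 : ∀ i U, GlobReads (K i) 2 U (𝔬 i).blk (𝔬 i).blkY (evY i) ((𝔬 i).Gp U ∘ₗ (𝔬 i).Dstar U))
    (hgl3 : ∀ i U, GlobReads (K i) 3 U (𝔬 i).blk (𝔬 i).blk (ev i) ((𝔬 i).Lap U ∘ₗ (𝔬 i).Gp U))
    (hl0 : ∀ i U, L2ReadsNbr (R := R i) (H := H i) (K i) 0 U (Rel i) r Cev (𝔬 i).blk (𝔬 i).blk (ev i) ((𝔬 i).Gp U))
    (hl1 : ∀ i U, L2ReadsNbr (R := R i) (H := H i) (K i) 1 U (Rel i) r Cev (𝔬 i).blkY (𝔬 i).blk (ev i) ((𝔬 i).D U ∘ₗ (𝔬 i).Gp U))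
    (hl2 : ∀ i U, L2ReadsNbr (R := R i) (H := H i) (K i) 2 U (Rel i) r Cev (𝔬 i).blk (𝔬 i).blkY (evY i)
      ((𝔬 i).Gp U ∘ₗ (𝔬 i).Dstar U))
    (hl3 : ∀ i U, L2ReadsNbr (R := R i) (H := H i) (K i) 3 U (Rel i) r Cev ((𝔬 i).blk ∘ Prod.fst) (𝔬 i).blk (ev i)
      (familyOp fun p : Q i × Q i => (𝔡 i).Dd U p.1 ∘ₗ ((𝔬 i).Gp U ∘ₗ (𝔡 i).Dsd U p.2)))
    (hl4 : ∀ i U, L2ReadsNbr (R := R i) (H := H i) (K i) 4 U (Rel i) r Cev ((𝔬 i).blk ∘ Prod.fst) (𝔬 i).blk (ev i)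
      (familyOp fun p : Q i × Q i => ((𝔡 i).Dd U p.1 ∘ₗ (𝔡 i).Dd U p.2) ∘ₗ (𝔬 i).Gp U))
    (hl5 : ∀ i U, L2ReadsNbr (R := R i) (H := H i) (K i) 5 U (Rel i) r Cev ((𝔬 i).blk ∘ Prod.fst) (𝔬 i).blk (ev i)
      (familyOp fun p : Q i × Q i => (𝔬 i).Gp U ∘ₗ ((𝔡 i).Dsd U p.1 ∘ₗ (𝔡 i).Dsd U p.2)))
    (hH1 : ∀ i U, H1ReadsNbr (K i) U (𝔭 i) (Rel i) r (𝔬 i).blk (𝔬 i).blkY (ev i) (evY i) ((𝔬 i).D U ∘ₗ (𝔬 i).Gp U)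
      ((𝔬 i).Gp U ∘ₗ (𝔬 i).Dstar U))
    (hIR : ∀ i U, InputReadsFam (K i) U (bHX i) r ((𝔬 i).blk ∘ Prod.fst) ((𝔭 i).blkPX ∘ Prod.fst)
      (fun β => sliceProbe ((𝔭 i).ΦX U β)) (ev i)
      (familyOp fun p : Q i × Q i => (𝔡 i).Dd U p.1 ∘ₗ ((𝔬 i).Gp U ∘ₗ (𝔡 i).Dsd U p.2)))
    (hsym : ∀ i, M₁ ≤ (geo i).M → ∀ α₀ : ℝ, 0 < α₀ → c35 * (geo i).M * α₀ ≤ a₁ →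
      ∀ U : (bg i).Cfg, (bg i).Reg335 c35 α₀ U → IsTransposePair ((𝔬 i).Gp U) ((𝔬 i).Gp U))
    (htr : ∀ i, M₁ ≤ (geo i).M → ∀ α₀ : ℝ, 0 < α₀ → c35 * (geo i).M * α₀ ≤ a₁ →
      ∀ U : (bg i).Cfg, (bg i).Reg335 c35 α₀ U → IsTransposePair ((𝔬 i).D U ∘ₗ (𝔬 i).Gp U) ((𝔬 i).Gp U ∘ₗ (𝔬 i).Dstar U))
    (hfacts : ∀ i, Mg ≤ (geo i).M → Facts347 (geo i) (R i) (H i) d δ α L₀)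
    (hdsymm : ∀ i (a b : (geo i).Site), (geo i).dist a b = (geo i).dist b a)
    (hC : 0 ≤ C) (hCB : (m : ℝ) * C ≤ B₀) (hCL : (mN : ℝ) * m * Cev * CL ^ 2 * Real.exp (r * δ₀) * (C * L₀) ≤ B₀)
    (hδ₀nn : 0 ≤ δ₀) (hδ₀ : δ₀ ≤ (1 - α) * δ)
    (hδ₀2 : δ₀ ≤ (1 - 2 * α) * δ) (hα : 0 ≤ α * δ) (hα2 : 2 * α * δ ≤ δ) (hCg : C * B6.c1 d δ (1 - α) * L₀ ^ (4 : ℝ) ≤ B₀)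
    (hc : 0 < c35) (ha₁ : 0 < a₁) (hα₁ : 0 ≤ α₁) (hα₁2 : α₁ ≤ 1 / 2) (hN' : 0 ≤ N')
    (hB₁ : 0 ≤ B₁) (hNH : 0 ≤ NH) (hM₁ : 0 < M₁) (hδnn : 0 ≤ δ) (hδ5 : δ ≤ (1 - 2 * α₁) * δ₁) (hδ₁ : 0 ≤ δ₁) (hN3 : 0 ≤ N3)
    (hB3 : 0 ≤ B3) (hθ3 : 0 ≤ θ3) (hNI : 0 ≤ NI) (hNM : 0 ≤ NM) (hBM : 0 ≤ BM) (hθM : 0 ≤ θM)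
    (hB35 : (mN : ℝ) * m * Cev * CL ^ 2 * Real.exp (r * δ₀) * (NQ * secondConst d₁ δ₁ α₁ N3 B3 N' θ3 C L₀) ≤ B₀)
    (hB3M : (mN : ℝ) * m * Cev * CL ^ 2 * Real.exp (r * δ₀) * (NQ * mixedConst d₁ δ₁ α₁ NM BM N' θM C L₀) ≤ B₀)
    (hst : ∀ i, StaticOK (𝔬 i) ρ N N' Cℓ (κ i)) (hκ : ∀ i, (κ i).Bounded Kc θ₀ Cℓ (geo i).M)
    (hcntH : ∀ i (a : (geo i).Site), (∑ q, if a ∈ SH i q then (1 : ℝ) else 0) ≤ NH)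
    (hcnt3 : ∀ i (a : (geo i).Site), (∑ q, if a ∈ S3 i q then (1 : ℝ) else 0) ≤ N3)
    (hNQ : ∀ i, (Fintype.card (Q i) : ℝ) ≤ NQ)
    (hcntI : ∀ i (a : (geo i).Site), (∑ q, if a ∈ SI i q then (1 : ℝ) else 0) ≤ NI)
    (hcntM : ∀ i (a : (geo i).Site), (∑ q, if a ∈ SM i q then (1 : ℝ) else 0) ≤ NM)
    (hBl : ∀ β, 0 ≤ β → β < 1 → 0 ≤ Bl β) (hBV : ∀ β, 0 ≤ β → β < 1 → 0 ≤ BV β)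
    (hBI : ∀ ε, 0 < ε → ε ≤ 1 → 0 ≤ BI ε) (hBI2 : ∀ ε β, 0 < ε → ε ≤ 1 → 0 ≤ β → β < 1 → 0 ≤ BI2 ε β)
    (hθI : ∀ ε, 0 < ε → 0 ≤ θI ε)
    (hBβ : ∀ β, 0 ≤ β → β < 1 → (m : ℝ) * CL * Real.exp (r * δ₀) * holderConst d₁ δ₁ α₁ NH N' C (Bl β) (BV β) ≤ Bβ β)
    (hBε : ∀ ε, 0 < ε → ε ≤ 1 → Real.exp (r * δ₀) * inputConst44 d₁ δ₁ α₁ NI N' C L₀ (BI ε) (θI ε) ≤ Bε ε)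
    (hBεβ : ∀ ε β, 0 < ε → ε ≤ 1 → 0 ≤ β → β < 1 →
      CL * Real.exp (r * δ₀) *
        inputConst45 d₁ δ₁ α₁ NI N' L₀ (holderConst d₁ δ₁ α₁ NH N' C (Bl β) (BV β)) (BI2 ε β) (θI (β + ε)) ≤ Bεβ ε β)
    (h261 : ∀ i, ML ≤ (geo i).M → Ineq261 d₁ (toB6 (geo i) (R i) (H i)) δ₁ α₁)
    (hop : ∀ i, M₁ ≤ (geo i).M → ∀ α₀ : ℝ, 0 < α₀ → c35 * (geo i).M * α₀ ≤ a₁ →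
      ∀ U : (bg i).Cfg, (bg i).Reg335 c35 α₀ U →
        Local342 (𝔬 i) (R i) (H i) B₁ δ₁ U ∧ Identities (𝔬 i) (R i) (H i) U ∧
          HolderLegs37 (𝔬 i) (𝔭 i) (R i) (H i) (SH i) Bl δ₁ U ∧ HolderV37 (𝔬 i) (𝔭 i) (R i) (H i) BV δ₁ U)
    (hop3 : ∀ i, M₁ ≤ (geo i).M → ∀ α₀ : ℝ, 0 < α₀ → c35 * (geo i).M * α₀ ≤ a₁ →
      ∀ U : (bg i).Cfg, (bg i).Reg335 c35 α₀ U →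
        L2SecondLegs37 (𝔬 i) (𝔡 i) (R i) (H i) (S3 i) B3 δ₁ U ∧ FactorsL2Second37 (𝔬 i) (𝔡 i) (R i) (H i) θ3 δ₁ U ∧
          DirTranspose37 (𝔬 i) (𝔡 i) U)
    (hopI : ∀ i, M₁ ≤ (geo i).M → ∀ α₀ : ℝ, 0 < α₀ → c35 * (geo i).M * α₀ ≤ a₁ →
      ∀ U : (bg i).Cfg, (bg i).Reg335 c35 α₀ U →
        InputLegsPair37 (𝔬 i) (𝔡 i) (𝔭 i) (R i) (H i) (bHX i) (SI i) BI BI2 δ₁ U ∧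
          FactorsInputPair37 (𝔬 i) (𝔡 i) (R i) (H i) (bHX i) θI δ₁ U ∧ DirSupHolder37 (𝔬 i) (𝔡 i) (𝔭 i) (R i) (H i) U)
    (hopM : ∀ i, M₁ ≤ (geo i).M → ∀ α₀ : ℝ, 0 < α₀ → c35 * (geo i).M * α₀ ≤ a₁ →
      ∀ U : (bg i).Cfg, (bg i).Reg335 c35 α₀ U →
        L2MixedLegs37 (𝔬 i) (𝔡 i) (R i) (H i) (SM i) BM δ₁ U ∧ FactorsL2Mixed37 (𝔬 i) (𝔡 i) (R i) (H i) θM δ₁ U ∧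
          DirSup37 (𝔬 i) (𝔡 i) (R i) (H i) U) :
    B9.Thm37Printed c35 geo bg (fun i => E37AllOfOps (𝔴 i) (𝔬 i) (R i) (H i) C δ (K i) B₀ δ₀ Bβ Bε Bεβ) := by
  have hαδ₁ : 0 ≤ α₁ * δ₁ := mul_nonneg hα₁ hδ₁
  have hrate : (1 - 2 * α) * δ ≤ (1 - α₁) * δ₁ := by nlinarith [hα, hδ5, hαδ₁]
  have hδδ₁ : δ ≤ (1 - α₁) * δ₁ := hδ5.trans (by nlinarith [hαδ₁])
  have hα₁1 : α₁ ≤ 1 := by linarith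
  have hαδ1 : α * δ ≤ δ := by linarith
  have hc1 : 0 ≤ B6.c1 d₁ δ₁ α₁ := c1_nonneg d₁ δ₁ α₁
  have hBe : 0 ≤ B₁ * Real.exp (δ₁ * ρ) := mul_nonneg hB₁ (Real.exp_nonneg _)
  set Mbig : ℝ := 2 * N' * (B₁ * Real.exp (δ₁ * ρ) * θ₀) * B6.c1 d₁ δ₁ α₁ with hMbig
  refine thm37Printed_strengthen h37 (max (max Mg M₁) (max (max ML M₁) Mbig)) (a₁ / c35) (div_pos ha₁ hc)
    fun i hM α₀ hα₀ hMa U hU hconv => ?_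
  have hMg : Mg ≤ (geo i).M := le_trans (le_trans (le_max_left _ _) (le_max_left _ _)) hM
  have hM₁i : M₁ ≤ (geo i).M := le_trans (le_trans (le_max_right _ _) (le_max_left _ _)) hM
  have hMLi : ML ≤ (geo i).M := le_trans (le_trans (le_trans (le_max_left _ _) (le_max_left _ _)) (le_max_right _ _)) hM
  have hMb : Mbig ≤ (geo i).M := le_trans (le_trans (le_max_right _ _) (le_max_right _ _)) hM
  have hMpos : 0 < (geo i).M := lt_of_lt_of_le hM₁ hM₁i
  have ha : c35 * (geo i).M * α₀ ≤ a₁ := by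
    have h1 : (geo i).M * α₀ * c35 ≤ a₁ := (le_div_iff₀ hc).mp hMa
    calc c35 * (geo i).M * α₀ = (geo i).M * α₀ * c35 := by ring
      _ ≤ a₁ := h1
  have hconv' : Conv342 (𝔬 i) (R i) (H i) C δ U := hconv
  obtain ⟨h0, h1, h2, h3⟩ := hconv'
  obtain ⟨hl, hi, hL, hV⟩ := hop i hM₁i α₀ hα₀ ha U hU
  obtain ⟨hL3, hFL3, hDT⟩ := hop3 i hM₁i α₀ hα₀ ha U hU
  obtain ⟨hIL, hFI, hDH⟩ := hopI i hM₁i α₀ hα₀ ha U hU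
  obtain ⟨hLM, hFLM, hDS⟩ := hopM i hM₁i α₀ hα₀ ha U hU
  have hq : N' * (B₁ * Real.exp (δ₁ * ρ) * ((κ i).kP + (κ i).kC)) * B6.c1 d₁ δ₁ α₁ ≤ 1 / 2 :=
    small_of_size_pair hN' hBe hc1 hMpos (hκ i).row (by rw [hMbig] at hMb; exact hMb)
  have hq' : N' * (B₁ * Real.exp (δ₁ * ρ) * ((κ i).kPt + Cℓ * (κ i).kCt)) * B6.c1 d₁ δ₁ α₁ ≤ 1 / 2 :=
    small_of_size_pair hN' hBe hc1 hMpos (hκ i).col (by rw [hMbig] at hMb; exact hMb)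
  have hF := hfacts i hMg
  have hL₀ : 0 ≤ L₀ := le_trans (le_trans zero_le_one hF.one_le_L) hF.L_le
  have hlen : ∀ y : (geo i).Site, 0 < (geo i).len y := (hst i).lenpos
  -- the operator-level majorants of the members (3.43), (3.46) K-indices 4∕5 (pair families), (3.44)∕(3.45), (3.46) K-index 3 (mixed)
  have hH := holder343_of_local37 (𝔬 i) (𝔭 i) (R i) (H i) d₁ δ₁ α₁ ρ B₁ N N' Cℓ NH C δ (κ i) (SH i) Bl BV U hB₁ hδ₁ hα₁
    hα₁1 hN' hNH hC hδnn hδδ₁ (hst i) (hκ i).nonneg (hcntH i) hBl hBV (h261 i hMLi) hq hl hi hL hV h2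
  have hH' : ∀ β : ℝ, 0 ≤ β → β < 1 →
      HasMajorantHom (g := toB6 (geo i) (R i) (H i)) (𝔬 i).blk (𝔭 i).blkPY ((𝔭 i).ΦY U β ∘ₗ ((𝔬 i).D U ∘ₗ (𝔬 i).Gp U))
          (fun (a b : (geo i).Site) => holderConst d₁ δ₁ α₁ NH N' C (Bl β) (BV β) * (geo i).len a ^ (1 - β) *
            Real.exp (-(δ * (geo i).dist a b))) ∧
        HasMajorantHom (g := toB6 (geo i) (R i) (H i)) (𝔬 i).blkY (𝔭 i).blkPX ((𝔭 i).ΦX U β ∘ₗ ((𝔬 i).Gp U ∘ₗ (𝔬 i).Dstar U))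
          (fun (a b : (geo i).Site) => holderConst d₁ δ₁ α₁ NH N' C (Bl β) (BV β) * (geo i).len a ^ (1 - β) *
            Real.exp (-(δ * (geo i).dist a b))) := by
    intro β hβ0 hβ1
    have h := hH β hβ0 hβ1
    rw [LinearMap.comp_assoc] at h
    exact h
  have hK2 : 0 ≤ secondConst d₁ δ₁ α₁ N3 B3 N' θ3 C L₀ := secondConst_nonneg hN3 hB3 hN' hθ3 hC hL₀
  have hwk : ∀ a b : (geo i).Site, (Fintype.card (Q i) : ℝ) * secondConst d₁ δ₁ α₁ N3 B3 N' θ3 C L₀ *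
      Real.exp (-((1 - 2 * α) * δ * (geo i).dist a b)) ≤ NQ * secondConst d₁ δ₁ α₁ N3 B3 N' θ3 C L₀ *
      Real.exp (-((1 - 2 * α) * δ * (geo i).dist a b)) := fun a b =>
    mul_le_mul_of_nonneg_right (mul_le_mul_of_nonneg_right (hNQ i) hK2) (Real.exp_nonneg _)
  have hb4f := (blockBd_second_family3_37 (𝔬 i) (𝔡 i) (R i) (H i) d d₁ δ α L₀ δ₁ α₁ ρ N N' Cℓ N3 B3 θ3 C (κ i) (S3 i) U hN' hN3
    hB3 hθ3 hC hα2 hαδ₁ hrate (hst i) (hcnt3 i) (h261 i hMLi) hF hi hL3 hFL3 hDT h0 (hsym i hM₁i α₀ hα₀ ha U hU)).mono hwk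
  have hb5 := (blockBd_second_family5_37 (𝔬 i) (𝔡 i) (R i) (H i) d d₁ δ α L₀ δ₁ α₁ ρ N N' Cℓ N3 B3 θ3 C (κ i) (S3 i) U hN' hN3
    hB3 hθ3 hC hα2 hαδ₁ hrate (hst i) (hcnt3 i) (h261 i hMLi) hF hi hL3 hFL3 h0 (hsym i hM₁i α₀ hα₀ ha U hU)).mono hwk
  -- the nonnegativity of the Hölder constant; the mixed family's L² bound and its (3.44)∕(3.45) majorants (sliced probes)
  have hK0 : ∀ β, 0 ≤ β → β < 1 → 0 ≤ holderConst d₁ δ₁ α₁ NH N' C (Bl β) (BV β) := by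
    intro β hβ0 hβ1
    have hb := hBl β hβ0 hβ1
    have hv := hBV β hβ0 hβ1
    unfold holderConst
    positivity
  obtain ⟨h44, h45⟩ := inputPair3445_family_37 (𝔬 i) (𝔡 i) (𝔭 i) (R i) (H i) (bHX i) d d₁ δ α L₀ δ₁ α₁ ρ N N' Cℓ NI C (κ i)
    (SI i) (fun β => holderConst d₁ δ₁ α₁ NH N' C (Bl β) (BV β)) BI θI BI2 U hδ₁ hα₁ hN' hNI hC hδδ₁ hα hαδ1 (hst i)
    (hcntI i) hK0 hBI hBI2 hθI (h261 i hMLi) hF hi hIL hFI hDS hDH h1 (fun β hβ0 hβ1 => (hH β hβ0 hβ1).1)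
  have hKM : 0 ≤ mixedConst d₁ δ₁ α₁ NM BM N' θM C L₀ := mixedConst_nonneg hNM hBM hN' hθM hC hL₀
  have hwkM : ∀ a b : (geo i).Site, (Fintype.card (Q i) : ℝ) * mixedConst d₁ δ₁ α₁ NM BM N' θM C L₀ *
      Real.exp (-((1 - 2 * α) * δ * (geo i).dist a b)) ≤ NQ * mixedConst d₁ δ₁ α₁ NM BM N' θM C L₀ *
      Real.exp (-((1 - 2 * α) * δ * (geo i).dist a b)) := fun a b =>
    mul_le_mul_of_nonneg_right (mul_le_mul_of_nonneg_right (hNQ i) hKM) (Real.exp_nonneg _)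
  have hb3f := (blockBd_mixed_family_37 (𝔬 i) (𝔡 i) (R i) (H i) d d₁ δ α L₀ δ₁ α₁ ρ N N' Cℓ NM BM θM C (κ i) (SM i) U hN' hNM
    hBM hθM hC hα2 hαδ₁ hrate (hst i) (hcntM i) (h261 i hMLi) hF hi hLM hFLM hDS hDT h1 h2 (hsym i hM₁i α₀ hα₀ ha U hU)).mono hwkM
  -- the nonnegativity of the operator-level constants
  have hK35 : 0 ≤ NQ * secondConst d₁ δ₁ α₁ N3 B3 N' θ3 C L₀ :=
    mul_nonneg ((Nat.cast_nonneg _).trans (hNQ i)) hK2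
  have hK3M : 0 ≤ NQ * mixedConst d₁ δ₁ α₁ NM BM N' θM C L₀ :=
    mul_nonneg ((Nat.cast_nonneg _).trans (hNQ i)) hKM
  have hK44 : ∀ ε, 0 < ε → ε ≤ 1 → 0 ≤ inputConst44 d₁ δ₁ α₁ NI N' C L₀ (BI ε) (θI ε) := by
    intro ε hε0 hε1
    have hb := hBI ε hε0 hε1
    have ht := hθI ε hε0
    unfold inputConst44
    positivity
  have hK45 : ∀ ε β, 0 < ε → ε ≤ 1 → 0 ≤ β → β < 1 →
      0 ≤ inputConst45 d₁ δ₁ α₁ NI N' L₀ (holderConst d₁ δ₁ α₁ NH N' C (Bl β) (BV β)) (BI2 ε β) (θI (β + ε)) := by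
    intro ε β hε0 hε1 hβ0 hβ1
    have hb := hBI2 ε β hε0 hε1 hβ0 hβ1
    have ht := hθI (β + ε) (by linarith)
    have hh := hK0 β hβ0 hβ1
    unfold inputConst45
    positivity
  exact ⟨⟨h0, h1, h2, h3⟩, allIneqs_of_majorants_pairM (R := R i) (H := H i) (𝔭 i) (bHX i) (𝔬 i).blk (𝔬 i).blkY (ev i)
    (evY i) (Rel i) m r Cev CL mN (hRlen i) (hRd₁ i) (hRd₂ i) (hmult i) (hnbr i) hCL1 (hCLcmp i) (htri i) hCev h0 h1 h2 h3
    hH' hb3f hb4f hb5 h44 h45 (hsym i hM₁i α₀ hα₀ ha U hU) (htr i hM₁i α₀ hα₀ ha U hU)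
    (hco0 i U) (hco1 i U) (hco2 i U) (hco3 i U) (hgl0 i U) (hgl1 i U) (hgl2 i U) (hgl3 i U) (hl0 i U) (hl1 i U) (hl2 i U)
    (hl3 i U) (hl4 i U) (hl5 i U) (hH1 i U) (hIR i U) hF (hdsymm i) (hst i).dnn hlen hC hK35 hK3M hK0 hK44 hK45 hα hδ₀nn hδ₀
    hδ₀2 hCB hCg hCL hB35 hB3M hBβ hBε hBεβ⟩

end AllPinsGp

end

end Literature.MathematicalPhysics.QuantumFieldTheory.Balaban1983to89.B9RWSumsAllBlocksPairM
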